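import Literature.NumberTheory.Transcendental.Waldschmidt1980SizesB
import Literature.NumberTheory.Transcendental.StewartYuPadicDescentSetup
import HarnessLib

/-!
# The `p`-adic Cijsouw–Waldschmidt/Waldschmidt 2-descent, Ib: the `p`-adic Waldschmidt parameter record `PadicW80Par` (parts A–D) (re-homed cell library `abc-stewartyu`)

**Part Ib of V** of the VERBATIM re-homing of the cell library `Summits/ABC/StewartYu/*` (cell `abc-stewartyu`: the kernel `p`-adic Baker
bound for logarithms of rational primes and its abc consequences) into `Literature/` by the Hodge foundations lane (prover p20,
generation 39).  Provenance convention (docstrings byte-for-byte; `[folklore]` kept and supplemented by a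
`[cite: … (source FOLLOWED …; the cell's adaptation, NOT a printed statement)]` tag because the gate no longer admits `[folklore]`
alone on a public theorem), the renaming convention (trailing prime on the helpers inside `…PadicCW77.Setup` / `…CW77.Setup`) and
the source list are stated in full in the header of Part Ia, `Literature/NumberTheory/Transcendental/StewartYuPadicDescentSetup.lean`;
namespace `Summit.ABC.StewartYu` → `Literature.NumberTheory.Transcendental.StewartYu`; imports from `Literature/` and Mathlib only;
one `section PartK` per source module; no `sorry`, no new axiom, NO named fact (D-0026).

THIS FILE (4 source modules, every declaration: `PadicW80Par`, `PadicW80ParB`, `PadicW80ParC`, `PadicW80ParD`): the `p`-adic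
Waldschmidt parameter record `PadicW80Par` — the cell's twin of the tree's archimedean `Waldschmidt1980Params/ParamsB.lean`
(`c_S = 2¹⁵`, an arbitrary `1 ≤ V_θ ≤ V_max`) — and its inequalities (parts A–D).  Omitted declarations: none.
[Waldschmidt1980] [Yu1989]
-/

noncomputable section

/-!
## Part 1 — port of `Summits/ABC/StewartYu/PadicW80Par.lean`

# The `p`-adic Waldschmidt parameters (WP-A4, cell abc-stewartyu): the record `PadicW80Par`

Support file (plain definitions and theorems; no named facts). Twin of
`Waldschmidt1980Params/ParamsB.lean` (+ the `S₀`-dependent parts of `…Sizes/Numeric/Main`) for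
the `p`-adic Cijsouw–Waldschmidt/Waldschmidt descent (`PadicCW77Main`). TWO changes w.r.t. `W80Par`:
* (F-p2-3, p2) in the `p`-adic set-up the eliminated generator `θ` carries a coefficient of MINIMAL
  `p`-adic order and is NOT the one of largest height: the record has an arbitrary `1 ≤ V_θ ≤ V_max`
  next to `1 ≤ Vⱼ ≤ V_max`; `V_max` replaces `V_f`/`V_θ` inside the logarithms `W⋆ = max(W,
  m log(2¹³ m V_max))`, `G = m log(2¹⁷ m V_max)`, while `U = Aᵐ m^{2m+3}/m! · (∏Vⱼ) V_θ · W⋆ · G`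
  keeps the true `V_θ`; the (unused) ordering lemma `L_θ ≤ Lⱼ` is dropped;
* (R-g, p1) `c_S = 2¹⁵` in place of `2¹³`: the `p`-adic extrapolation gains only `(log p)/2 ≥ 0.549`
  per zero (radius `√p`; `PadicNewton.norm_tsum_le_max_of_small_jets_int'`, Yu 1989 Lemma 1.4)
  against W80's `log 21`, and all inequalities are homogeneous in `𝔘 = U/2ᵐ`, so only the zeros-per-𝔘
  ratio `kpts·t_J/(2ᵏ𝔘) ≈ c_S/(2c_T)` can pay: `KT_le`/`KT_ge` now give `(31/32)·2ᵏ𝔘 ≤ kpts·t_J ≤ 2ᵏ𝔘`.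
Everything else (`c_T, c_L, c_L', Ap`, `T, h, L_b, Lⱼ, L_θ, J₀, t_J`, the Siegel count
`CW77.Setup.padic_siegel_count`, the endgame numbers) is W80's with the same proofs (HOME/p1/WP-A4-table.md).

## References
* [Waldschmidt1980] M. Waldschmidt, *A lower bound for linear forms in logarithms*, Acta Arith. 37
  (1980), 257–283 — §3.2 (3.7)–(3.14) (pp. 264–265), Lemmas 3.2, 3.5 (pp. 266, 271), §3.5 (p. 274).
* [Yu1989] K. Yu, *Linear forms in p-adic logarithms*, Acta Arith. 53 (1989) — Lemma 1.4 (p. 117),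
  (3.11) (p. 133).
-/

section Part1

open _root_.Finset _root_.Real
open Literature.NumberTheory.Transcendental Literature.NumberTheory.Transcendental.Waldschmidt1980

namespace Literature.NumberTheory.Transcendental.StewartYu

/-- **The parameters of the `p`-adic Waldschmidt descent.** `d ≥ 1` free logarithms of sizes
`1 ≤ Vⱼ ≤ V_max`, the eliminated one of size `1 ≤ V_θ ≤ V_max` (NOT necessarily the largest:
p2's FLAG F-p2-3), and the coefficient bound `W ≥ 1`. [cite: Waldschmidt1980, §3.1–3.2 (pp. 263–264)] -/
structure PadicW80Par (d : ℕ) where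
  /-- sizes of the free logarithms -/
  Vs : Fin d → ℝ
  /-- a common bound for ALL the sizes (inside the logarithms `W⋆`, `G`) -/
  Vmax : ℝ
  /-- the size of the eliminated logarithm -/
  Vel : ℝ
  /-- the coefficient bound (`W ≥ log max |bⱼ|`) -/
  Wb : ℝ
  /-- `Vⱼ ≥ 1` -/
  hV : ∀ j, 1 ≤ Vs j
  /-- `Vⱼ ≤ V_max` -/
  hVmax : ∀ j, Vs j ≤ Vmax
  /-- `1 ≤ V_max` -/
  hVmax1 : 1 ≤ Vmax
  /-- `1 ≤ V_θ` -/
  hVθ1 : 1 ≤ Vel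
  /-- `V_θ ≤ V_max` -/
  hVθmax : Vel ≤ Vmax
  /-- `W ≥ 1` -/
  hW : 1 ≤ Wb
  /-- at least one free logarithm -/
  hd : 1 ≤ d

namespace PadicW80Par

variable {d : ℕ} (P : PadicW80Par d)

/-! ### The constants -/

/-- `c_T = 2¹⁴`. [folklore]
[cite: Waldschmidt1980, §3.2 (3.7)–(3.14) (pp. 264–265) (source FOLLOWED: the archimedean parameter choice of which this record is the cell’s p-adic twin with c_S = 2¹⁵; NOT a printed statement)] -/
def cTp : ℝ := 2 ^ 14
/-- `c_S = 2¹³` (`c_S/c_T = 1/2`). [folklore]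
[cite: Waldschmidt1980, §3.2 (3.7)–(3.14) (pp. 264–265) (source FOLLOWED: the archimedean parameter choice of which this record is the cell’s p-adic twin with c_S = 2¹⁵; NOT a printed statement)] -/
def cSp : ℝ := 2 ^ 15
/-- `c_L = 2¹⁴`. [folklore]
[cite: Waldschmidt1980, §3.2 (3.7)–(3.14) (pp. 264–265) (source FOLLOWED: the archimedean parameter choice of which this record is the cell’s p-adic twin with c_S = 2¹⁵; NOT a printed statement)] -/
def cLp : ℝ := 2 ^ 14
/-- `c_L' = 2¹²`. [folklore]
[cite: Waldschmidt1980, §3.2 (3.7)–(3.14) (pp. 264–265) (source FOLLOWED: the archimedean parameter choice of which this record is the cell’s p-adic twin with c_S = 2¹⁵; NOT a printed statement)] -/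
def cLp' : ℝ := 2 ^ 12
/-- `Ap = 2⁵⁰` (the base of the constant `Aᵐ`). [folklore]
[cite: Waldschmidt1980, §3.2 (3.7)–(3.14) (pp. 264–265) (source FOLLOWED: the archimedean parameter choice of which this record is the cell’s p-adic twin with c_S = 2¹⁵; NOT a printed statement)] -/
def Ap : ℝ := 2 ^ 50

/-! ### The derived parameters -/

/-- The number of logarithms `m = d + 1`, as a real number. [folklore]
[cite: Waldschmidt1980, §3.2 (3.7)–(3.14) (pp. 264–265) (source FOLLOWED: the archimedean parameter choice of which this record is the cell’s p-adic twin with c_S = 2¹⁵; NOT a printed statement)] -/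
def mRp (d : ℕ) : ℝ := (d : ℝ) + 1

/-- `W⋆ = max(W, m log(2¹³ m V_θ))` (Waldschmidt's `W*`, (3.2)). [cite: Waldschmidt1980, §3.2 (p. 264)] -/
def Wstarp : ℝ := max P.Wb (mRp d * Real.log (2 ^ 13 * mRp d * P.Vmax))

/-- `G = m log(2¹⁷ m V_f)` (Waldschmidt's `log V*_{n−1}`, (3.2)). [cite: Waldschmidt1980, §3.2 (p. 264)] -/
def Gp : ℝ := mRp d * Real.log (2 ^ 17 * mRp d * P.Vmax)

/-- **`U = Aᵐ · m^{2m+1}/m! · (∏ Vⱼ) V_θ · W⋆ · G`** (Waldschmidt's `U₂`, p. 264).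
[cite: Waldschmidt1980, §3.1 (p. 264)] -/
def Up : ℝ := Ap ^ (d + 1) * (mRp d ^ (2 * d + 3) / (d + 1).factorial) * ((∏ j, P.Vs j) * P.Vel) *
  P.Wstarp * P.Gp

/-- `S₀ = 2 ⌊c_S m W⋆⌋` (even; the points of level `0` are the odd `s < S₀`). [cite: Waldschmidt1980, (3.2) p. 264] -/
def S₀p : ℕ := 2 * ⌊cSp * mRp d * P.Wstarp⌋₊

/-- `T = ⌊U/(c_T 2ᵐ W⋆)⌋`. [cite: Waldschmidt1980, (3.2) p. 264] -/
def Tp : ℕ := ⌊P.Up / (cTp * 2 ^ (d + 1) * P.Wstarp)⌋₊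

/-- `h = ⌊W⋆/G⌋ + 1` (the block length of the `Δ`-polynomials, Waldschmidt's `L₋₁ + 1`).
[cite: Waldschmidt1980, (3.2) p. 264] -/
def hparp : ℕ := ⌊P.Wstarp / P.Gp⌋₊ + 1

/-- `L_b = ⌊U/(c_L 2ᵐ G h)⌋ + 1` (the number of blocks, Waldschmidt's `L₀ + 1`). [cite: Waldschmidt1980, (3.2) p. 264] -/
def Lbp : ℕ := ⌊P.Up / (cLp * 2 ^ (d + 1) * P.Gp * P.hparp)⌋₊ + 1

/-- `Lⱼ = ⌊U/(c_L' m 2^{m+1} S₀ Vⱼ)⌋`. [cite: Waldschmidt1980, (3.2) p. 264] -/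
def Lp (j : Fin d) : ℕ := ⌊P.Up / (cLp' * mRp d * 2 ^ (d + 2) * P.S₀p * P.Vs j)⌋₊

/-- `L_θ = ⌊U/(c_L' m 2^{m+1} S₀ V_θ)⌋` (the smallest range). [cite: Waldschmidt1980, (3.2) p. 264] -/
def Lθp : ℕ := ⌊P.Up / (cLp' * mRp d * 2 ^ (d + 2) * P.S₀p * P.Vel)⌋₊

/-- `J₀ = [log₂ L_θ] + 1` descent steps. [cite: Waldschmidt1980, §3.5 (p. 274)] -/
def J₀p : ℕ := Nat.log 2 P.Lθp + 1

/-! ### Elementary inequalities -/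

/-- `1 ≤ m`, `2 ≤ m`. [folklore]
[cite: Waldschmidt1980, §3.2 (3.7)–(3.14) (pp. 264–265) (source FOLLOWED: the archimedean parameter choice of which this record is the cell’s p-adic twin with c_S = 2¹⁵; NOT a printed statement)] -/
theorem two_le_mR (P : PadicW80Par d) : (2 : ℝ) ≤ mRp d := by
  have h1 : (1 : ℝ) ≤ d := by exact_mod_cast P.hd
  unfold mRp
  linarith

/-- `0 < m`. [folklore]
[cite: Waldschmidt1980, §3.2 (3.7)–(3.14) (pp. 264–265) (source FOLLOWED: the archimedean parameter choice of which this record is the cell’s p-adic twin with c_S = 2¹⁵; NOT a printed statement)] -/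
theorem mR_pos (P : PadicW80Par d) : (0 : ℝ) < mRp d := by linarith [(two_le_mR P)]

/-- `1 ≤ V_θ`. [folklore]
[cite: Waldschmidt1980, §3.2 (3.7)–(3.14) (pp. 264–265) (source FOLLOWED: the archimedean parameter choice of which this record is the cell’s p-adic twin with c_S = 2¹⁵; NOT a printed statement)] -/
theorem one_le_Vθ : (1 : ℝ) ≤ P.Vel := P.hVθ1

/-- `1 ≤ V_max`. [folklore]
[cite: Waldschmidt1980, §3.2 (3.7)–(3.14) (pp. 264–265) (source FOLLOWED: the archimedean parameter choice of which this record is the cell’s p-adic twin with c_S = 2¹⁵; NOT a printed statement)] -/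
theorem one_le_Vmax : (1 : ℝ) ≤ P.Vmax := P.hVmax1

/-- `W⋆ ≥ W ≥ 1`. [folklore]
[cite: Waldschmidt1980, §3.2 (3.7)–(3.14) (pp. 264–265) (source FOLLOWED: the archimedean parameter choice of which this record is the cell’s p-adic twin with c_S = 2¹⁵; NOT a printed statement)] -/
theorem W_le_Wstar : P.Wb ≤ P.Wstarp := le_max_left _ _

/-- `1 ≤ W⋆`. [folklore]
[cite: Waldschmidt1980, §3.2 (3.7)–(3.14) (pp. 264–265) (source FOLLOWED: the archimedean parameter choice of which this record is the cell’s p-adic twin with c_S = 2¹⁵; NOT a printed statement)] -/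
theorem one_le_Wstar : (1 : ℝ) ≤ P.Wstarp := P.hW.trans P.W_le_Wstar

/-- `W⋆ ≥ m log(2¹³ m V_θ)`. [folklore]
[cite: Waldschmidt1980, §3.2 (3.7)–(3.14) (pp. 264–265) (source FOLLOWED: the archimedean parameter choice of which this record is the cell’s p-adic twin with c_S = 2¹⁵; NOT a printed statement)] -/
theorem mlog_le_Wstar : mRp d * Real.log (2 ^ 13 * mRp d * P.Vmax) ≤ P.Wstarp := le_max_right _ _

/-- `log(2¹³ m V_θ) ≥ 9` (`2¹³ · 2 = 2¹⁴ ≥ e⁹`). [folklore]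
[cite: Waldschmidt1980, §3.2 (3.7)–(3.14) (pp. 264–265) (source FOLLOWED: the archimedean parameter choice of which this record is the cell’s p-adic twin with c_S = 2¹⁵; NOT a printed statement)] -/
theorem nine_le_log : (9 : ℝ) ≤ Real.log (2 ^ 13 * mRp d * P.Vmax) := by
  have h1 : (2 : ℝ) ^ 14 ≤ 2 ^ 13 * mRp d * P.Vmax := by
    have := (two_le_mR P); have := P.hVmax1
    calc (2 : ℝ) ^ 14 = 2 ^ 13 * 2 * 1 := by norm_num
      _ ≤ 2 ^ 13 * mRp d * P.Vmax := by gcongr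
  have h2 : Real.exp 9 ≤ (2 : ℝ) ^ 14 := by
    have := Real.exp_one_lt_d9
    calc Real.exp 9 = Real.exp 1 ^ 9 := by rw [← Real.exp_nat_mul]; norm_num
      _ ≤ (2.7182818286 : ℝ) ^ 9 := by gcongr
      _ ≤ 2 ^ 14 := by norm_num
  calc (9 : ℝ) = Real.log (Real.exp 9) := (Real.log_exp 9).symm
    _ ≤ Real.log (2 ^ 13 * mRp d * P.Vmax) := Real.log_le_log (Real.exp_pos _) (h2.trans h1)

/-- `W⋆ ≥ 9m ≥ 18`. [folklore]
[cite: Waldschmidt1980, §3.2 (3.7)–(3.14) (pp. 264–265) (source FOLLOWED: the archimedean parameter choice of which this record is the cell’s p-adic twin with c_S = 2¹⁵; NOT a printed statement)] -/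
theorem nine_mR_le_Wstar : 9 * mRp d ≤ P.Wstarp := by
  have h := P.mlog_le_Wstar
  have h9 := P.nine_le_log
  have hm := (mR_pos P)
  nlinarith

/-- `log(2¹⁷ m V_f) ≥ 11` (`2¹⁸ ≥ e¹¹`). [folklore]
[cite: Waldschmidt1980, §3.2 (3.7)–(3.14) (pp. 264–265) (source FOLLOWED: the archimedean parameter choice of which this record is the cell’s p-adic twin with c_S = 2¹⁵; NOT a printed statement)] -/
theorem eleven_le_logG : (11 : ℝ) ≤ Real.log (2 ^ 17 * mRp d * P.Vmax) := by
  have h1 : (2 : ℝ) ^ 18 ≤ 2 ^ 17 * mRp d * P.Vmax := by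
    have := (two_le_mR P); have := P.hVmax1
    calc (2 : ℝ) ^ 18 = 2 ^ 17 * 2 * 1 := by norm_num
      _ ≤ 2 ^ 17 * mRp d * P.Vmax := by gcongr
  have h2 : Real.exp 11 ≤ (2 : ℝ) ^ 18 := by
    have := Real.exp_one_lt_d9
    calc Real.exp 11 = Real.exp 1 ^ 11 := by rw [← Real.exp_nat_mul]; norm_num
      _ ≤ (2.7182818286 : ℝ) ^ 11 := by gcongr
      _ ≤ 2 ^ 18 := by norm_num
  calc (11 : ℝ) = Real.log (Real.exp 11) := (Real.log_exp 11).symm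
    _ ≤ Real.log (2 ^ 17 * mRp d * P.Vmax) := Real.log_le_log (Real.exp_pos _) (h2.trans h1)

/-- `G ≥ 11 m ≥ 22`. [folklore]
[cite: Waldschmidt1980, §3.2 (3.7)–(3.14) (pp. 264–265) (source FOLLOWED: the archimedean parameter choice of which this record is the cell’s p-adic twin with c_S = 2¹⁵; NOT a printed statement)] -/
theorem eleven_mR_le_G : 11 * mRp d ≤ P.Gp := by
  unfold Gp; have := P.eleven_le_logG; have := (mR_pos P); nlinarith

/-- `0 < G`. [folklore]
[cite: Waldschmidt1980, §3.2 (3.7)–(3.14) (pp. 264–265) (source FOLLOWED: the archimedean parameter choice of which this record is the cell’s p-adic twin with c_S = 2¹⁵; NOT a printed statement)] -/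
theorem G_pos : 0 < P.Gp := by have := P.eleven_mR_le_G; have := (mR_pos P); nlinarith

/-- **`G ≤ 2 W⋆`**: `2¹⁷ m V_f ≤ (2¹³ m V_θ)²`. [folklore]
[cite: Waldschmidt1980, §3.2 (3.7)–(3.14) (pp. 264–265) (source FOLLOWED: the archimedean parameter choice of which this record is the cell’s p-adic twin with c_S = 2¹⁵; NOT a printed statement)] -/
theorem G_le_two_Wstar : P.Gp ≤ 2 * P.Wstarp := by
  have hm := (two_le_mR P)
  have hVθ := P.hVmax1
  have h1 : (2 : ℝ) ^ 17 * mRp d * P.Vmax ≤ (2 ^ 13 * mRp d * P.Vmax) ^ 2 := by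
    have hVf0 : P.Vmax ≤ P.Vmax := le_rfl
    have hm1 : 1 ≤ mRp d := by linarith
    have hVf1 := P.hVmax1
    have e : (2 ^ 13 * mRp d * P.Vmax) ^ 2 = (2 : ℝ) ^ 26 * ((mRp d * mRp d) * (P.Vmax * P.Vmax)) := by ring
    rw [e]
    have h2 : mRp d * P.Vmax ≤ (mRp d * mRp d) * (P.Vmax * P.Vmax) := by
      calc mRp d * P.Vmax ≤ mRp d * P.Vmax := mul_le_mul_of_nonneg_left hVf0 (by linarith)
        _ = (mRp d * 1) * (P.Vmax * 1) := by ring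
        _ ≤ (mRp d * mRp d) * (P.Vmax * P.Vmax) := by gcongr
    calc (2 : ℝ) ^ 17 * mRp d * P.Vmax = 2 ^ 17 * (mRp d * P.Vmax) := by ring
      _ ≤ 2 ^ 26 * (mRp d * P.Vmax) := by gcongr <;> norm_num
      _ ≤ 2 ^ 26 * ((mRp d * mRp d) * (P.Vmax * P.Vmax)) := by gcongr
  have hpos : (0 : ℝ) < 2 ^ 17 * mRp d * P.Vmax := by have := P.hVmax1; positivity
  calc P.Gp = mRp d * Real.log (2 ^ 17 * mRp d * P.Vmax) := rfl
    _ ≤ mRp d * Real.log ((2 ^ 13 * mRp d * P.Vmax) ^ 2) :=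
        mul_le_mul_of_nonneg_left (Real.log_le_log hpos h1) (mR_pos P).le
    _ = 2 * (mRp d * Real.log (2 ^ 13 * mRp d * P.Vmax)) := by rw [Real.log_pow]; push_cast; ring
    _ ≤ 2 * P.Wstarp := by linarith [P.mlog_le_Wstar]

/-- `0 < U`. [folklore]
[cite: Waldschmidt1980, §3.2 (3.7)–(3.14) (pp. 264–265) (source FOLLOWED: the archimedean parameter choice of which this record is the cell’s p-adic twin with c_S = 2¹⁵; NOT a printed statement)] -/
theorem U_pos : 0 < P.Up := by
  unfold Up Ap
  have := P.one_le_Wstar; have := P.G_pos; have := P.one_le_Vθ; have := (mR_pos P)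
  have hV : 0 < ∏ j, P.Vs j := prod_pos fun j _ => lt_of_lt_of_le one_pos (P.hV j)
  positivity

/-- **The size of the unit `U/2ᵐ`**: `U/(2ᵐ W⋆) ≥ 2^{49m} · G · (∏ Vⱼ) V_θ ≥ 2^{49m}`
(`m^{2m+1}/m! ≥ 1`). [folklore]
[cite: Waldschmidt1980, §3.2 (3.7)–(3.14) (pp. 264–265) (source FOLLOWED: the archimedean parameter choice of which this record is the cell’s p-adic twin with c_S = 2¹⁵; NOT a printed statement)] -/
theorem U_div_ge : (2 : ℝ) ^ (49 * (d + 1)) * P.Gp * ((∏ j, P.Vs j) * P.Vel) * P.Wstarp ≤ P.Up / 2 ^ (d + 1) := by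
  unfold Up Ap
  rw [le_div_iff₀ (by positivity)]
  have hfac : (1 : ℝ) ≤ mRp d ^ (2 * d + 3) / (d + 1).factorial := by
    rw [le_div_iff₀ (by positivity), one_mul]
    have h1 : ((d + 1).factorial : ℝ) ≤ ((d + 1 : ℕ) : ℝ) ^ (d + 1) := by
      exact_mod_cast Nat.factorial_le_pow (d + 1)
    have h2 : ((d + 1 : ℕ) : ℝ) ^ (d + 1) ≤ mRp d ^ (2 * d + 3) := by
      have hm : ((d + 1 : ℕ) : ℝ) = mRp d := by unfold mRp; push_cast; ring
      rw [hm]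
      exact pow_le_pow_right₀ (by linarith [(two_le_mR P)]) (by omega)
    exact h1.trans h2
  have hW := P.one_le_Wstar; have hG := P.G_pos; have hVθ := P.one_le_Vθ
  have hV : 1 ≤ ∏ j, P.Vs j := by
    have : ∏ _j : Fin d, (1 : ℝ) ≤ ∏ j, P.Vs j :=
      prod_le_prod (fun _ _ => zero_le_one) fun j _ => P.hV j
    simpa using this
  have hVV : 0 ≤ (∏ j, P.Vs j) * P.Vel := by positivity
  have hpow : (2 : ℝ) ^ (49 * (d + 1)) * 2 ^ (d + 1) = (2 ^ 50) ^ (d + 1) := by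
    rw [← pow_mul, ← pow_add]; congr 1; ring
  calc (2 : ℝ) ^ (49 * (d + 1)) * P.Gp * ((∏ j, P.Vs j) * P.Vel) * P.Wstarp * 2 ^ (d + 1)
      = (2 ^ 50) ^ (d + 1) * 1 * ((∏ j, P.Vs j) * P.Vel) * P.Wstarp * P.Gp := by rw [← hpow]; ring
    _ ≤ (2 ^ 50) ^ (d + 1) * (mRp d ^ (2 * d + 3) / (d + 1).factorial) * ((∏ j, P.Vs j) * P.Vel) *
          P.Wstarp * P.Gp := by gcongr

/-- `U/(2ᵐ W⋆) ≥ 2^{49m}` (a convenient weak form). [folklore]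
[cite: Waldschmidt1980, §3.2 (3.7)–(3.14) (pp. 264–265) (source FOLLOWED: the archimedean parameter choice of which this record is the cell’s p-adic twin with c_S = 2¹⁵; NOT a printed statement)] -/
theorem U_div_ge' : (2 : ℝ) ^ (49 * (d + 1)) ≤ P.Up / (2 ^ (d + 1) * P.Wstarp) := by
  have h := P.U_div_ge
  have hW := P.one_le_Wstar
  have hG : 1 ≤ P.Gp := by have := P.eleven_mR_le_G; have := (two_le_mR P); nlinarith
  have hV : 1 ≤ (∏ j, P.Vs j) * P.Vel := by
    have h1 : 1 ≤ ∏ j, P.Vs j := by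
      have : ∏ _j : Fin d, (1 : ℝ) ≤ ∏ j, P.Vs j :=
        prod_le_prod (fun _ _ => zero_le_one) fun j _ => P.hV j
      simpa using this
    nlinarith [P.one_le_Vθ]
  rw [le_div_iff₀ (by positivity)]
  rw [le_div_iff₀ (by positivity)] at h
  have h49 : (0 : ℝ) ≤ 2 ^ (49 * (d + 1)) := by positivity
  calc (2 : ℝ) ^ (49 * (d + 1)) * (2 ^ (d + 1) * P.Wstarp)
      = 2 ^ (49 * (d + 1)) * 1 * 1 * P.Wstarp * 2 ^ (d + 1) := by ring
    _ ≤ 2 ^ (49 * (d + 1)) * P.Gp * ((∏ j, P.Vs j) * P.Vel) * P.Wstarp * 2 ^ (d + 1) := by gcongr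
    _ ≤ P.Up := h

/-! ### `S₀`, `T` -/

/-- `S₀` is even. [folklore]
[cite: Waldschmidt1980, §3.2 (3.7)–(3.14) (pp. 264–265) (source FOLLOWED: the archimedean parameter choice of which this record is the cell’s p-adic twin with c_S = 2¹⁵; NOT a printed statement)] -/
theorem even_S₀ : Even P.S₀p := ⟨⌊cSp * mRp d * P.Wstarp⌋₊, by unfold S₀p; ring⟩

/-- `c_S m W⋆ ≥ 2¹⁴`. [folklore]
[cite: Waldschmidt1980, §3.2 (3.7)–(3.14) (pp. 264–265) (source FOLLOWED: the archimedean parameter choice of which this record is the cell’s p-adic twin with c_S = 2¹⁵; NOT a printed statement)] -/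
theorem cS_mul_ge : (2 : ℝ) ^ 14 ≤ cSp * mRp d * P.Wstarp := by
  unfold cSp
  have := (two_le_mR P); have := P.one_le_Wstar
  calc (2 : ℝ) ^ 14 ≤ 2 ^ 15 * 2 * 1 := by norm_num
    _ ≤ 2 ^ 15 * mRp d * P.Wstarp := by gcongr

/-- `S₀ ≤ 2 c_S m W⋆`. [folklore]
[cite: Waldschmidt1980, §3.2 (3.7)–(3.14) (pp. 264–265) (source FOLLOWED: the archimedean parameter choice of which this record is the cell’s p-adic twin with c_S = 2¹⁵; NOT a printed statement)] -/
theorem S₀_le : (P.S₀p : ℝ) ≤ 2 * (cSp * mRp d * P.Wstarp) := by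
  unfold S₀p
  push_cast
  have := Nat.floor_le (show 0 ≤ cSp * mRp d * P.Wstarp by have := P.cS_mul_ge; linarith)
  linarith

/-- `c_S m W⋆ ≤ S₀` (indeed `S₀ ≥ 2 c_S m W⋆ − 2`). [folklore]
[cite: Waldschmidt1980, §3.2 (3.7)–(3.14) (pp. 264–265) (source FOLLOWED: the archimedean parameter choice of which this record is the cell’s p-adic twin with c_S = 2¹⁵; NOT a printed statement)] -/
theorem S₀_ge : cSp * mRp d * P.Wstarp ≤ P.S₀p := by
  unfold S₀p
  push_cast
  have h1 := Nat.lt_floor_add_one (cSp * mRp d * P.Wstarp)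
  have h2 := P.cS_mul_ge
  linarith

/-- `2 ≤ S₀`. [folklore]
[cite: Waldschmidt1980, §3.2 (3.7)–(3.14) (pp. 264–265) (source FOLLOWED: the archimedean parameter choice of which this record is the cell’s p-adic twin with c_S = 2¹⁵; NOT a printed statement)] -/
theorem two_le_S₀ : 2 ≤ P.S₀p := by
  have h := P.S₀_ge
  have h2 := P.cS_mul_ge
  have : (2 : ℝ) ≤ P.S₀p := by linarith
  exact_mod_cast this

/-- `0 < S₀` (real). [folklore]
[cite: Waldschmidt1980, §3.2 (3.7)–(3.14) (pp. 264–265) (source FOLLOWED: the archimedean parameter choice of which this record is the cell’s p-adic twin with c_S = 2¹⁵; NOT a printed statement)] -/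
theorem S₀_pos : (0 : ℝ) < P.S₀p := by have := P.two_le_S₀; exact_mod_cast (by omega : 0 < P.S₀p)

/-- `T ≤ U/(c_T 2ᵐ W⋆)`. [folklore]
[cite: Waldschmidt1980, §3.2 (3.7)–(3.14) (pp. 264–265) (source FOLLOWED: the archimedean parameter choice of which this record is the cell’s p-adic twin with c_S = 2¹⁵; NOT a printed statement)] -/
theorem T_le : (P.Tp : ℝ) ≤ P.Up / (cTp * 2 ^ (d + 1) * P.Wstarp) := by
  unfold Tp
  exact Nat.floor_le (by unfold cTp; have := P.U_pos; have := P.one_le_Wstar; positivity)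

/-- `U/(c_T 2ᵐ W⋆) ≥ 2`. [folklore]
[cite: Waldschmidt1980, §3.2 (3.7)–(3.14) (pp. 264–265) (source FOLLOWED: the archimedean parameter choice of which this record is the cell’s p-adic twin with c_S = 2¹⁵; NOT a printed statement)] -/
theorem two_le_U_div_cT : (2 : ℝ) ≤ P.Up / (cTp * 2 ^ (d + 1) * P.Wstarp) := by
  have h := P.U_div_ge'
  have hW := P.one_le_Wstar
  unfold cTp
  rw [le_div_iff₀ (by positivity)]
  rw [le_div_iff₀ (by positivity)] at h
  have h50 : (2 : ℝ) * 2 ^ 14 ≤ 2 ^ (49 * (d + 1)) := by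
    calc (2 : ℝ) * 2 ^ 14 = 2 ^ 15 := by norm_num
      _ ≤ 2 ^ (49 * (d + 1)) := pow_le_pow_right₀ (by norm_num) (by omega)
  calc (2 : ℝ) * (2 ^ 14 * 2 ^ (d + 1) * P.Wstarp) = (2 * 2 ^ 14) * (2 ^ (d + 1) * P.Wstarp) := by ring
    _ ≤ 2 ^ (49 * (d + 1)) * (2 ^ (d + 1) * P.Wstarp) := by gcongr
    _ ≤ P.Up := h

/-- `U/(2 c_T 2ᵐ W⋆) ≤ T` (the floor costs at most a factor `2`). [folklore]
[cite: Waldschmidt1980, §3.2 (3.7)–(3.14) (pp. 264–265) (source FOLLOWED: the archimedean parameter choice of which this record is the cell’s p-adic twin with c_S = 2¹⁵; NOT a printed statement)] -/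
theorem T_ge : P.Up / (cTp * 2 ^ (d + 1) * P.Wstarp) / 2 ≤ P.Tp := by
  unfold Tp
  have h1 := Nat.lt_floor_add_one (P.Up / (cTp * 2 ^ (d + 1) * P.Wstarp))
  have h2 := P.two_le_U_div_cT
  linarith

/-- `1 ≤ T`. [folklore]
[cite: Waldschmidt1980, §3.2 (3.7)–(3.14) (pp. 264–265) (source FOLLOWED: the archimedean parameter choice of which this record is the cell’s p-adic twin with c_S = 2¹⁵; NOT a printed statement)] -/
theorem one_le_T : 1 ≤ P.Tp := by
  have h := P.T_ge
  have h2 := P.two_le_U_div_cT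
  have : (1 : ℝ) ≤ P.Tp := by linarith
  exact_mod_cast this

/-! ### `L_θ`, `Lⱼ`, `J₀` -/

/-- The denominator of `L_θ` is positive. [folklore]
[cite: Waldschmidt1980, §3.2 (3.7)–(3.14) (pp. 264–265) (source FOLLOWED: the archimedean parameter choice of which this record is the cell’s p-adic twin with c_S = 2¹⁵; NOT a printed statement)] -/
theorem den_Lθ_pos : 0 < cLp' * mRp d * 2 ^ (d + 2) * P.S₀p * P.Vel := by
  unfold cLp'; have := (mR_pos P); have := P.S₀_pos; have := P.one_le_Vθ; positivity

/-- `L_θ ≤ U/(c_L' m 2^{m+1} S₀ V_θ)`. [folklore]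
[cite: Waldschmidt1980, §3.2 (3.7)–(3.14) (pp. 264–265) (source FOLLOWED: the archimedean parameter choice of which this record is the cell’s p-adic twin with c_S = 2¹⁵; NOT a printed statement)] -/
theorem Lθ_le : (P.Lθp : ℝ) ≤ P.Up / (cLp' * mRp d * 2 ^ (d + 2) * P.S₀p * P.Vel) := by
  unfold Lθp
  exact Nat.floor_le (div_nonneg P.U_pos.le P.den_Lθ_pos.le)

end PadicW80Par

end Literature.NumberTheory.Transcendental.StewartYu

end Part1

/-!
## Part 2 — port of `Summits/ABC/StewartYu/PadicW80ParB.lean`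

# The `p`-adic Waldschmidt parameter record — part B (sequel of `PadicW80Par`)

Support file (plain definitions and theorems; no named facts): continuation of the twin of
`Waldschmidt1980Params/ParamsB/Sizes/Numeric/Main` on the record `PadicW80Par`
(design, HOME/p1/WP-A4-table.md: `V_max` inside the logarithms `W⋆, G` and an ARBITRARY eliminated size
`1 ≤ V_el ≤ V_max` in `U` — p2's FLAG F-p2-3; `c_S = 2¹⁵` — the `p`-adic zeros-per-`𝔘` ratio; all names carry a
suffix `p` to keep them apart from the archimedean record `W80Par`). [cite: Waldschmidt1980, §3.2–3.5 (pp. 264–274)]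
-/

section Part2

open _root_.Finset _root_.Real
open Literature.NumberTheory.Transcendental Literature.NumberTheory.Transcendental.Waldschmidt1980

namespace Literature.NumberTheory.Transcendental.StewartYu

namespace PadicW80Par

variable {d : ℕ} (P : PadicW80Par d)

/-- `U/(c_L' m 2^{m+1} S₀ V_θ) ≥ 2`. [folklore]
[cite: Waldschmidt1980, §3.2 (3.7)–(3.14) (pp. 264–265) (source FOLLOWED; p-adic twin of the archimedean parameter inequalities, the cell’s adaptation, NOT a printed statement)] -/
theorem two_le_U_div_Lθden : (2 : ℝ) ≤ P.Up / (cLp' * mRp d * 2 ^ (d + 2) * P.S₀p * P.Vel) := by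
  rw [le_div_iff₀ P.den_Lθ_pos]
  have h := P.U_div_ge
  rw [le_div_iff₀ (by positivity)] at h
  have hS := P.S₀_le
  have hm := (two_le_mR P)
  have hG : 11 * mRp d ≤ P.Gp := P.eleven_mR_le_G
  have hVθ := P.one_le_Vθ
  have hW := P.one_le_Wstar
  have hV1 : 1 ≤ ∏ j, P.Vs j := by
    have : ∏ _j : Fin d, (1 : ℝ) ≤ ∏ j, P.Vs j := prod_le_prod (fun _ _ => zero_le_one) fun j _ => P.hV j
    simpa using this
  -- `2 · c_L' m 2^{d+2} S₀ Vθ ≤ 2^{29} m² W⋆ Vθ ≤ 2^{49m} G (∏V) Vθ W⋆ 2^{d+1}`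
  unfold cLp' cSp at *
  have hmm : mRp d * mRp d ≤ 2 ^ (2 * (d + 1)) := by
    have hmle : mRp d ≤ 2 ^ (d + 1) := by
      unfold mRp
      have : ((d : ℝ) + 1) = ((d + 1 : ℕ) : ℝ) := by push_cast; ring
      rw [this]; exact_mod_cast (Nat.lt_two_pow_self).le
    calc mRp d * mRp d ≤ 2 ^ (d + 1) * 2 ^ (d + 1) := mul_le_mul hmle hmle (mR_pos P).le (by positivity)
      _ = 2 ^ (2 * (d + 1)) := by rw [← pow_add]; ring_nf
  calc 2 * (2 ^ 12 * mRp d * 2 ^ (d + 2) * (P.S₀p : ℝ) * P.Vel)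
      ≤ 2 * (2 ^ 12 * mRp d * 2 ^ (d + 2) * (2 * (2 ^ 15 * mRp d * P.Wstarp)) * P.Vel) := by gcongr
    _ = 2 ^ 30 * (mRp d * mRp d) * (2 ^ (d + 1) * P.Wstarp * P.Vel) := by ring
    _ ≤ 2 ^ 30 * 2 ^ (2 * (d + 1)) * (2 ^ (d + 1) * P.Wstarp * P.Vel) := by gcongr
    _ = 2 ^ (30 + 2 * (d + 1)) * 1 * 1 * P.Vel * P.Wstarp * 2 ^ (d + 1) := by rw [pow_add]; ring
    _ ≤ 2 ^ (49 * (d + 1)) * P.Gp * (∏ j, P.Vs j) * P.Vel * P.Wstarp * 2 ^ (d + 1) := by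
        have hG0 : 0 ≤ P.Gp := by linarith
        have hG1 : 1 ≤ P.Gp := by linarith
        have hpow : (2 : ℝ) ^ (30 + 2 * (d + 1)) ≤ 2 ^ (49 * (d + 1)) :=
          pow_le_pow_right₀ (by norm_num) (by omega)
        gcongr
    _ = 2 ^ (49 * (d + 1)) * P.Gp * ((∏ j, P.Vs j) * P.Vel) * P.Wstarp * 2 ^ (d + 1) := by ring
    _ ≤ P.Up := h

/-- `U/(2 c_L' m 2^{m+1} S₀ V_θ) ≤ L_θ`. [folklore]
[cite: Waldschmidt1980, §3.2 (3.7)–(3.14) (pp. 264–265) (source FOLLOWED; p-adic twin of the archimedean parameter inequalities, the cell’s adaptation, NOT a printed statement)] -/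
theorem Lθ_ge : P.Up / (cLp' * mRp d * 2 ^ (d + 2) * P.S₀p * P.Vel) / 2 ≤ P.Lθp := by
  unfold Lθp
  have h1 := Nat.lt_floor_add_one (P.Up / (cLp' * mRp d * 2 ^ (d + 2) * P.S₀p * P.Vel))
  have h2 := P.two_le_U_div_Lθden
  linarith

/-- `1 ≤ L_θ`. [folklore]
[cite: Waldschmidt1980, §3.2 (3.7)–(3.14) (pp. 264–265) (source FOLLOWED; p-adic twin of the archimedean parameter inequalities, the cell’s adaptation, NOT a printed statement)] -/
theorem one_le_Lθ : 1 ≤ P.Lθp := by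
  have h := P.Lθ_ge
  have h2 := P.two_le_U_div_Lθden
  have : (1 : ℝ) ≤ P.Lθp := by linarith
  exact_mod_cast this

/-- `L_θ < 2^{J₀}`. [folklore]
[cite: Waldschmidt1980, §3.2 (3.7)–(3.14) (pp. 264–265) (source FOLLOWED; p-adic twin of the archimedean parameter inequalities, the cell’s adaptation, NOT a printed statement)] -/
theorem Lθ_lt_two_pow : P.Lθp < 2 ^ P.J₀p := Nat.lt_pow_succ_log_self one_lt_two _

/-- `2^{J₀} ≤ 2 L_θ`. [folklore]
[cite: Waldschmidt1980, §3.2 (3.7)–(3.14) (pp. 264–265) (source FOLLOWED; p-adic twin of the archimedean parameter inequalities, the cell’s adaptation, NOT a printed statement)] -/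
theorem two_pow_le : 2 ^ P.J₀p ≤ 2 * P.Lθp := by
  unfold J₀p
  rw [pow_succ]
  have := Nat.pow_log_le_self 2 (show P.Lθp ≠ 0 by have := P.one_le_Lθ; omega)
  omega

/-- `1 ≤ J₀`. [folklore]
[cite: Waldschmidt1980, §3.2 (3.7)–(3.14) (pp. 264–265) (source FOLLOWED; p-adic twin of the archimedean parameter inequalities, the cell’s adaptation, NOT a printed statement)] -/
theorem one_le_J₀ : 1 ≤ P.J₀p := Nat.le_add_left 1 _

/-- **`T ≥ 2¹¹ m² V_θ L_θ`**: the derivatives outnumber the smallest exponent range by the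
factor `c_L' c_S m² V_θ/c_T` — the source of all the room in the numerical conditions
(`T/2^{J₀} ≥ 2¹⁰ m² V_θ`). [cite: Waldschmidt1980, (3.10) and (3.14) (p. 265)] -/
theorem T_ge_Lθ : (2 : ℝ) ^ 11 * mRp d ^ 2 * P.Vel * P.Lθp ≤ P.Tp := by
  have hT := P.T_ge
  have hL := P.Lθ_le
  have hS := P.S₀_ge
  have hm := (mR_pos P)
  have hVθ := P.one_le_Vθ
  have hW := P.one_le_Wstar
  have hU := P.U_pos
  refine le_trans ?_ hT
  -- `2¹¹ m² Vθ · U/(c_L' m 2^{d+2} S₀ Vθ) ≤ U/(2 c_T 2^{d+1} W⋆)` since `S₀ ≥ c_S m W⋆`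
  unfold cTp cLp' cSp at *
  have hden : 0 < (2 : ℝ) ^ 12 * mRp d * 2 ^ (d + 2) * P.S₀p * P.Vel := by
    have := P.S₀_pos; positivity
  calc (2 : ℝ) ^ 11 * mRp d ^ 2 * P.Vel * P.Lθp
      ≤ 2 ^ 11 * mRp d ^ 2 * P.Vel * (P.Up / (2 ^ 12 * mRp d * 2 ^ (d + 2) * P.S₀p * P.Vel)) := by gcongr
    _ = P.Up * (mRp d / (2 * 2 ^ (d + 2) * P.S₀p)) := by field_simp
    _ ≤ P.Up * (mRp d / (2 * 2 ^ (d + 2) * (2 ^ 15 * mRp d * P.Wstarp))) := by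
        apply mul_le_mul_of_nonneg_left _ hU.le
        apply div_le_div_of_nonneg_left hm.le (by positivity)
        gcongr
    _ = P.Up / (2 ^ 16 * 2 ^ (d + 1) * P.Wstarp) / 2 := by field_simp; ring
    _ ≤ P.Up / (2 ^ 14 * 2 ^ (d + 1) * P.Wstarp) / 2 := by
        gcongr <;> norm_num

/-! ## Part B (twin of `Waldschmidt1980ParamsB`) -/

/-! ### The unit and the bound -/

/-- The unit `𝔘 = U / 2ᵐ` (`m = d + 1`). [cite: Waldschmidt1980, §3.3 (3.19) (p. 269)] -/
def 𝔘p : ℝ := P.Up / 2 ^ (d + 1)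

/-- The common bound `𝔅 = exp(𝔘/64)` of the moderate quantities. [folklore]
[cite: Waldschmidt1980, §3.2 (3.7)–(3.14) (pp. 264–265) (source FOLLOWED; p-adic twin of the archimedean parameter inequalities, the cell’s adaptation, NOT a printed statement)] -/
def 𝔅p : ℝ := Real.exp (P.𝔘p / 64)

/-- `U = 2ᵐ 𝔘`. [folklore]
[cite: Waldschmidt1980, §3.2 (3.7)–(3.14) (pp. 264–265) (source FOLLOWED; p-adic twin of the archimedean parameter inequalities, the cell’s adaptation, NOT a printed statement)] -/
theorem U_eq : P.Up = 2 ^ (d + 1) * P.𝔘p := by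
  unfold 𝔘p; field_simp

/-- **`𝔘 ≥ 2^{49m} G (∏Vⱼ) V_θ W⋆`.** [folklore]
[cite: Waldschmidt1980, §3.2 (3.7)–(3.14) (pp. 264–265) (source FOLLOWED; p-adic twin of the archimedean parameter inequalities, the cell’s adaptation, NOT a printed statement)] -/
theorem 𝔘_ge : (2 : ℝ) ^ (49 * (d + 1)) * P.Gp * ((∏ j, P.Vs j) * P.Vel) * P.Wstarp ≤ P.𝔘p := P.U_div_ge

/-- `1 ≤ ∏ Vⱼ`. [folklore]
[cite: Waldschmidt1980, §3.2 (3.7)–(3.14) (pp. 264–265) (source FOLLOWED; p-adic twin of the archimedean parameter inequalities, the cell’s adaptation, NOT a printed statement)] -/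
theorem one_le_prodV : (1 : ℝ) ≤ ∏ j, P.Vs j := by
  have : ∏ _j : Fin d, (1 : ℝ) ≤ ∏ j, P.Vs j := prod_le_prod (fun _ _ => zero_le_one) fun j _ => P.hV j
  simpa using this

/-- `1 ≤ G`. [folklore]
[cite: Waldschmidt1980, §3.2 (3.7)–(3.14) (pp. 264–265) (source FOLLOWED; p-adic twin of the archimedean parameter inequalities, the cell’s adaptation, NOT a printed statement)] -/
theorem one_le_G : (1 : ℝ) ≤ P.Gp := by
  have := P.eleven_mR_le_G; have := two_le_mR P; nlinarith

/-- **`2⁹⁸ W⋆ ≤ 𝔘`** (`m ≥ 2`). [folklore]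
[cite: Waldschmidt1980, §3.2 (3.7)–(3.14) (pp. 264–265) (source FOLLOWED; p-adic twin of the archimedean parameter inequalities, the cell’s adaptation, NOT a printed statement)] -/
theorem Wstar_le_𝔘 : (2 : ℝ) ^ 98 * P.Wstarp ≤ P.𝔘p := by
  have h := P.𝔘_ge
  have hG := P.one_le_G; have hV := P.one_le_prodV; have hVθ := P.one_le_Vθ; have hW := P.one_le_Wstar
  have hd : 98 ≤ 49 * (d + 1) := by have := P.hd; omega
  calc (2 : ℝ) ^ 98 * P.Wstarp ≤ 2 ^ (49 * (d + 1)) * P.Wstarp := by gcongr; norm_num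
    _ = 2 ^ (49 * (d + 1)) * 1 * (1 * 1) * P.Wstarp := by ring
    _ ≤ 2 ^ (49 * (d + 1)) * P.Gp * ((∏ j, P.Vs j) * P.Vel) * P.Wstarp := by gcongr
    _ ≤ P.𝔘p := h

/-- `2⁹⁸ G ≤ 𝔘`. [folklore]
[cite: Waldschmidt1980, §3.2 (3.7)–(3.14) (pp. 264–265) (source FOLLOWED; p-adic twin of the archimedean parameter inequalities, the cell’s adaptation, NOT a printed statement)] -/
theorem G_le_𝔘 : (2 : ℝ) ^ 98 * P.Gp ≤ P.𝔘p := by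
  have h := P.𝔘_ge
  have hG := P.one_le_G; have hV := P.one_le_prodV; have hVθ := P.one_le_Vθ; have hW := P.one_le_Wstar
  have hd : 98 ≤ 49 * (d + 1) := by have := P.hd; omega
  calc (2 : ℝ) ^ 98 * P.Gp ≤ 2 ^ (49 * (d + 1)) * P.Gp := by gcongr; norm_num
    _ = 2 ^ (49 * (d + 1)) * P.Gp * (1 * 1) * 1 := by ring
    _ ≤ 2 ^ (49 * (d + 1)) * P.Gp * ((∏ j, P.Vs j) * P.Vel) * P.Wstarp := by gcongr
    _ ≤ P.𝔘p := h

/-- `2⁹⁸ (∑Vⱼ + V_θ + 1)… `: the sizes are lower-order, `(∏Vⱼ) V_θ ≤ 2⁻⁹⁸ 𝔘`. [folklore]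
[cite: Waldschmidt1980, §3.2 (3.7)–(3.14) (pp. 264–265) (source FOLLOWED; p-adic twin of the archimedean parameter inequalities, the cell’s adaptation, NOT a printed statement)] -/
theorem prodV_le_𝔘 : (2 : ℝ) ^ 98 * ((∏ j, P.Vs j) * P.Vel) ≤ P.𝔘p := by
  have h := P.𝔘_ge
  have hG := P.one_le_G; have hV := P.one_le_prodV; have hVθ := P.one_le_Vθ; have hW := P.one_le_Wstar
  have hd : 98 ≤ 49 * (d + 1) := by have := P.hd; omega
  have h0 : 0 ≤ (∏ j, P.Vs j) * P.Vel := by positivity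
  calc (2 : ℝ) ^ 98 * ((∏ j, P.Vs j) * P.Vel) ≤ 2 ^ (49 * (d + 1)) * ((∏ j, P.Vs j) * P.Vel) := by gcongr; norm_num
    _ = 2 ^ (49 * (d + 1)) * 1 * ((∏ j, P.Vs j) * P.Vel) * 1 := by ring
    _ ≤ 2 ^ (49 * (d + 1)) * P.Gp * ((∏ j, P.Vs j) * P.Vel) * P.Wstarp := by gcongr
    _ ≤ P.𝔘p := h

/-- `∑ Vⱼ + V_θ ≤ (d+1) · (∏Vⱼ) V_θ` (each size is at most the product of all). [folklore]
[cite: Waldschmidt1980, §3.2 (3.7)–(3.14) (pp. 264–265) (source FOLLOWED; p-adic twin of the archimedean parameter inequalities, the cell’s adaptation, NOT a printed statement)] -/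
theorem sumV_le : (∑ j, P.Vs j) + P.Vel ≤ (mRp d) * ((∏ j, P.Vs j) * P.Vel) := by
  have hVθ := P.one_le_Vθ
  have hVj : ∀ j, P.Vs j ≤ (∏ i, P.Vs i) * P.Vel := by
    intro j
    have h1 : P.Vs j ≤ ∏ i, P.Vs i := by
      rw [← Finset.mul_prod_erase _ _ (mem_univ j)]
      have : 1 ≤ ∏ i ∈ (univ : Finset (Fin d)).erase j, P.Vs i := by
        have : ∏ _i ∈ (univ : Finset (Fin d)).erase j, (1 : ℝ) ≤ ∏ i ∈ (univ : Finset (Fin d)).erase j, P.Vs i :=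
          prod_le_prod (fun _ _ => zero_le_one) fun i _ => P.hV i
        simpa using this
      have h0 : 0 ≤ P.Vs j := le_trans zero_le_one (P.hV j)
      nlinarith
    have h0 : 0 ≤ ∏ i, P.Vs i := le_trans zero_le_one P.one_le_prodV
    nlinarith
  have hθ : P.Vel ≤ (∏ i, P.Vs i) * P.Vel := le_mul_of_one_le_left (by linarith) P.one_le_prodV
  calc (∑ j, P.Vs j) + P.Vel ≤ (∑ _j : Fin d, (∏ i, P.Vs i) * P.Vel) + (∏ i, P.Vs i) * P.Vel :=
        add_le_add (sum_le_sum fun j _ => hVj j) hθ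
    _ = (mRp d) * ((∏ j, P.Vs j) * P.Vel) := by
        simp only [sum_const, card_univ, Fintype.card_fin, nsmul_eq_mul]; unfold mRp; ring

/-- `m ≤ W⋆/9 ≤ 2⁻⁹⁸ 𝔘`. [folklore]
[cite: Waldschmidt1980, §3.2 (3.7)–(3.14) (pp. 264–265) (source FOLLOWED; p-adic twin of the archimedean parameter inequalities, the cell’s adaptation, NOT a printed statement)] -/
theorem mR_le_𝔘 : (2 : ℝ) ^ 98 * mRp d ≤ P.𝔘p := by
  have h1 := P.nine_mR_le_Wstar; have h2 := P.Wstar_le_𝔘; have := mR_pos P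
  nlinarith

/-- `∑Vⱼ + V_θ ≤ 2⁻⁹⁰ 𝔘`. [folklore]
[cite: Waldschmidt1980, §3.2 (3.7)–(3.14) (pp. 264–265) (source FOLLOWED; p-adic twin of the archimedean parameter inequalities, the cell’s adaptation, NOT a printed statement)] -/
theorem sumV_le_𝔘 : (2 : ℝ) ^ 90 * ((∑ j, P.Vs j) + P.Vel) ≤ P.𝔘p := by
  have h1 := P.sumV_le; have h2 := P.prodV_le_𝔘; have h3 := P.mR_le_𝔘
  have hm := mR_pos P
  have h0 : 0 ≤ (∏ j, P.Vs j) * P.Vel := by have := P.one_le_prodV; have := P.one_le_Vθ; positivity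
  -- `m · X ≤ (𝔘/2^98)(𝔘/2^98)`?? no: use `m X ≤ 2^{-98} 𝔘 · X`-free bound: `m ≤ 2^8` is false in general;
  -- instead `∑V + Vθ ≤ m X` and `m ≤ 𝔘/2^98`, `X ≤ 𝔘/2^98` would give a quadratic bound; we use
  -- `𝔘 ≥ 2^{49m} X ≥ 2^{90} · 2^{8} m · X` for `m ≥ 2` (`2^{49m−98} ≥ m`).
  have h := P.𝔘_ge
  have hG := P.one_le_G; have hW := P.one_le_Wstar
  have hpow : (2 : ℝ) ^ 90 * mRp d ≤ 2 ^ (49 * (d + 1)) := by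
    have hm2 : mRp d ≤ 2 ^ (d + 1) := by
      unfold mRp
      have : ((d : ℝ) + 1) = ((d + 1 : ℕ) : ℝ) := by push_cast; ring
      rw [this]; exact_mod_cast (Nat.lt_two_pow_self).le
    have hd := P.hd
    calc (2 : ℝ) ^ 90 * mRp d ≤ 2 ^ 90 * 2 ^ (d + 1) := by gcongr
      _ = 2 ^ (91 + d) := by rw [← pow_add]; ring_nf
      _ ≤ 2 ^ (49 * (d + 1)) := pow_le_pow_right₀ (by norm_num) (by omega)
  calc (2 : ℝ) ^ 90 * ((∑ j, P.Vs j) + P.Vel) ≤ 2 ^ 90 * ((mRp d) * ((∏ j, P.Vs j) * P.Vel)) := by gcongr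
    _ = (2 ^ 90 * mRp d) * ((∏ j, P.Vs j) * P.Vel) := by ring
    _ ≤ 2 ^ (49 * (d + 1)) * ((∏ j, P.Vs j) * P.Vel) := by gcongr
    _ = 2 ^ (49 * (d + 1)) * 1 * ((∏ j, P.Vs j) * P.Vel) * 1 := by ring
    _ ≤ 2 ^ (49 * (d + 1)) * P.Gp * ((∏ j, P.Vs j) * P.Vel) * P.Wstarp := by
        have h49 : (0 : ℝ) ≤ 2 ^ (49 * (d + 1)) := pow_nonneg zero_le_two _
        have hG0 : 0 ≤ P.Gp := by linarith
        exact mul_le_mul (mul_le_mul_of_nonneg_right (mul_le_mul_of_nonneg_left hG h49) h0) hW zero_le_one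
          (mul_nonneg (mul_nonneg h49 hG0) h0)
    _ ≤ P.𝔘p := h

/-- `0 < 𝔘`, indeed `2⁹⁸ ≤ 𝔘`. [folklore]
[cite: Waldschmidt1980, §3.2 (3.7)–(3.14) (pp. 264–265) (source FOLLOWED; p-adic twin of the archimedean parameter inequalities, the cell’s adaptation, NOT a printed statement)] -/
theorem 𝔘_ge' : (2 : ℝ) ^ 98 ≤ P.𝔘p := by
  have := P.Wstar_le_𝔘; have := P.one_le_Wstar; nlinarith

/-- `0 < 𝔘`. [folklore]
[cite: Waldschmidt1980, §3.2 (3.7)–(3.14) (pp. 264–265) (source FOLLOWED; p-adic twin of the archimedean parameter inequalities, the cell’s adaptation, NOT a printed statement)] -/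
theorem 𝔘_pos : 0 < P.𝔘p := lt_of_lt_of_le (by norm_num) P.𝔘_ge'

/-- `1 ≤ 𝔅`. [folklore]
[cite: Waldschmidt1980, §3.2 (3.7)–(3.14) (pp. 264–265) (source FOLLOWED; p-adic twin of the archimedean parameter inequalities, the cell’s adaptation, NOT a printed statement)] -/
theorem one_le_𝔅 : 1 ≤ P.𝔅p := Real.one_le_exp (div_nonneg P.𝔘_pos.le (by norm_num))

/-- `0 < 𝔅`. [folklore]
[cite: Waldschmidt1980, §3.2 (3.7)–(3.14) (pp. 264–265) (source FOLLOWED; p-adic twin of the archimedean parameter inequalities, the cell’s adaptation, NOT a printed statement)] -/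
theorem 𝔅_pos : 0 < P.𝔅p := Real.exp_pos _

/-- `exp y ≤ 𝔅` when `y ≤ 𝔘/64`. [folklore]
[cite: Waldschmidt1980, §3.2 (3.7)–(3.14) (pp. 264–265) (source FOLLOWED; p-adic twin of the archimedean parameter inequalities, the cell’s adaptation, NOT a printed statement)] -/
theorem exp_le_𝔅 {y : ℝ} (hy : y ≤ P.𝔘p / 64) : Real.exp y ≤ P.𝔅p := Real.exp_le_exp.mpr hy

/-- `y ≤ 𝔅` when `log y ≤ 𝔘/64`. [folklore]
[cite: Waldschmidt1980, §3.2 (3.7)–(3.14) (pp. 264–265) (source FOLLOWED; p-adic twin of the archimedean parameter inequalities, the cell’s adaptation, NOT a printed statement)] -/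
theorem le_𝔅_of_log_le {y : ℝ} (hy : Real.log y ≤ P.𝔘p / 64) : y ≤ P.𝔅p := by
  rcases le_or_gt y 0 with h | h
  · exact h.trans P.𝔅_pos.le
  · rw [← Real.exp_log h]; exact P.exp_le_𝔅 hy

/-! ### `T`, `S₀` against the unit -/

/-- **`T W⋆ ≤ 𝔘/c_T`.** [folklore]
[cite: Waldschmidt1980, §3.2 (3.7)–(3.14) (pp. 264–265) (source FOLLOWED; p-adic twin of the archimedean parameter inequalities, the cell’s adaptation, NOT a printed statement)] -/
theorem TWstar_le : (P.Tp : ℝ) * P.Wstarp ≤ P.𝔘p / cTp := by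
  have h := P.T_le
  have hW := P.one_le_Wstar
  unfold cTp at *
  rw [P.U_eq] at h
  rw [le_div_iff₀ (by positivity)] at h
  rw [le_div_iff₀ (by norm_num)]
  have key : ((P.Tp : ℝ) * P.Wstarp * 2 ^ 14) * 2 ^ (d + 1) ≤ P.𝔘p * 2 ^ (d + 1) := by
    calc ((P.Tp : ℝ) * P.Wstarp * 2 ^ 14) * 2 ^ (d + 1) = P.Tp * (2 ^ 14 * 2 ^ (d + 1) * P.Wstarp) := by ring
      _ ≤ 2 ^ (d + 1) * P.𝔘p := h
      _ = P.𝔘p * 2 ^ (d + 1) := by ring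
  exact le_of_mul_le_mul_right key (by positivity)

/-- `T ≤ 𝔘/c_T`. [folklore]
[cite: Waldschmidt1980, §3.2 (3.7)–(3.14) (pp. 264–265) (source FOLLOWED; p-adic twin of the archimedean parameter inequalities, the cell’s adaptation, NOT a printed statement)] -/
theorem T_le_𝔘 : (P.Tp : ℝ) ≤ P.𝔘p / cTp := by
  have h := P.TWstar_le; have hW := P.one_le_Wstar
  have hT : (0 : ℝ) ≤ P.Tp := Nat.cast_nonneg _
  nlinarith

/-- `0 < T` (real). [folklore]
[cite: Waldschmidt1980, §3.2 (3.7)–(3.14) (pp. 264–265) (source FOLLOWED; p-adic twin of the archimedean parameter inequalities, the cell’s adaptation, NOT a printed statement)] -/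
theorem T_pos : (0 : ℝ) < P.Tp := by have := P.one_le_T; exact_mod_cast this

end PadicW80Par

end Literature.NumberTheory.Transcendental.StewartYu

end Part2

/-!
## Part 3 — port of `Summits/ABC/StewartYu/PadicW80ParC.lean`

# The `p`-adic Waldschmidt parameter record — part C (sequel of `PadicW80ParB`)

Support file (plain definitions and theorems; no named facts): continuation of the twin of
`Waldschmidt1980Params/ParamsB/Sizes/Numeric/Main` on the record `PadicW80Par`
(design, HOME/p1/WP-A4-table.md: `V_max` inside the logarithms `W⋆, G` and an ARBITRARY eliminated size
`1 ≤ V_el ≤ V_max` in `U` — p2's FLAG F-p2-3; `c_S = 2¹⁵` — the `p`-adic zeros-per-`𝔘` ratio; all names carry a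
suffix `p` to keep them apart from the archimedean record `W80Par`). [cite: Waldschmidt1980, §3.2–3.5 (pp. 264–274)]
-/

section Part3

open _root_.Finset _root_.Real
open Literature.NumberTheory.Transcendental Literature.NumberTheory.Transcendental.Waldschmidt1980

namespace Literature.NumberTheory.Transcendental.StewartYu

namespace PadicW80Par

variable {d : ℕ} (P : PadicW80Par d)

/-- **`log U ≤ 10 W⋆`**: `U = Aᵐ m^{2m+1}/m! (∏V)V_θ W⋆ G` and each factor is `exp(O(W⋆))`
(`m log Ap ≤ 4W⋆`, `(2m+1) log m ≤ W⋆`, `∑ log Vⱼ + log V_θ ≤ W⋆`, `log W⋆ ≤ W⋆`, `log G ≤ 2W⋆`).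
[folklore]
[cite: Waldschmidt1980, §3.2–§3.3 (pp. 264–266) (source FOLLOWED; the cell’s p-adic adaptation, NOT a printed statement)] -/
theorem log_U_le : Real.log P.Up ≤ 10 * P.Wstarp := by
  have hW := P.one_le_Wstar; have hm := two_le_mR P; have hm0 := mR_pos P
  have hG := P.one_le_G; have hGW := P.G_le_two_Wstar
  have hVθ := P.one_le_Vθ; have hV := P.one_le_prodV; have hVm := P.one_le_Vmax
  have h9 := P.nine_mR_le_Wstar
  have hml := P.mlog_le_Wstar
  -- `U ≤ exp(10 W⋆)` multiplicatively
  apply (Real.log_le_iff_le_exp P.U_pos).mpr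
  -- factor bounds
  have f1 : Ap ^ (d + 1) ≤ Real.exp (4 * P.Wstarp) := by
    -- `Ap^m = 2^{50 m} ≤ e^{35 m} ≤ e^{4 W⋆}` since `9m ≤ W⋆`
    unfold Ap
    have h2 : (2 : ℝ) ^ 50 ≤ Real.exp 35 := by
      have := Real.exp_one_gt_d9
      have h3 : (2.7182818283 : ℝ) ^ 35 ≤ Real.exp 1 ^ 35 := by gcongr
      rw [← Real.exp_nat_mul] at h3
      norm_num at h3 ⊢
      linarith
    calc ((2 : ℝ) ^ 50) ^ (d + 1) ≤ (Real.exp 35) ^ (d + 1) := by gcongr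
      _ = Real.exp (35 * mRp d) := by rw [← Real.exp_nat_mul]; unfold mRp; push_cast; ring_nf
      _ ≤ Real.exp (4 * P.Wstarp) := Real.exp_le_exp.mpr (by nlinarith)
  have f2 : mRp d ^ (2 * d + 3) / (d + 1).factorial ≤ Real.exp (P.Wstarp) := by
    -- `m^{2m+1}/m! ≤ m^{m+1} e^{m}` (`m^m ≤ e^m m!`) and `(m+1) log m + m ≤ m (9 + log m) ≤ W⋆`
    have hfacpos : (0 : ℝ) < (d + 1).factorial := by exact_mod_cast Nat.factorial_pos _
    have hst := CW77.pow_self_le_exp_mul_factorial (d + 1)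
    have em : ((d + 1 : ℕ) : ℝ) = mRp d := by unfold mRp; push_cast; ring
    rw [em] at hst
    have hlogm : 0 ≤ Real.log (mRp d) := Real.log_nonneg (by linarith)
    have hlog13 : Real.log (2 ^ 13 * mRp d * P.Vmax) = Real.log (2 ^ 13 * P.Vmax) + Real.log (mRp d) := by
      rw [show (2 : ℝ) ^ 13 * mRp d * P.Vmax = (2 ^ 13 * P.Vmax) * mRp d by ring, Real.log_mul (by positivity) hm0.ne']
    have h13 : 9 ≤ Real.log (2 ^ 13 * P.Vmax) := by
      have e9 : Real.exp 9 ≤ 2 ^ 13 * P.Vmax := by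
        have := Real.exp_one_lt_d9
        calc Real.exp 9 = Real.exp 1 ^ 9 := by rw [← Real.exp_nat_mul]; norm_num
          _ ≤ (2.7182818286 : ℝ) ^ 9 := by gcongr
          _ ≤ 2 ^ 13 * 1 := by norm_num
          _ ≤ 2 ^ 13 * P.Vmax := by gcongr
      calc (9 : ℝ) = Real.log (Real.exp 9) := (Real.log_exp 9).symm
        _ ≤ _ := Real.log_le_log (Real.exp_pos _) e9
    -- `m^{2d+3}/(d+1)! ≤ m^{d+2} e^{d+1}`
    have h1 : mRp d ^ (2 * d + 3) / (d + 1).factorial ≤ mRp d ^ (d + 2) * Real.exp 1 ^ (d + 1) := by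
      rw [div_le_iff₀ hfacpos]
      calc mRp d ^ (2 * d + 3) = mRp d ^ (d + 2) * mRp d ^ (d + 1) := by rw [← pow_add]; ring_nf
        _ ≤ mRp d ^ (d + 2) * (Real.exp 1 ^ (d + 1) * (d + 1).factorial) :=
            mul_le_mul_of_nonneg_left hst (by positivity)
        _ = mRp d ^ (d + 2) * Real.exp 1 ^ (d + 1) * (d + 1).factorial := by ring
    refine h1.trans ?_
    have e1 : mRp d ^ (d + 2) * Real.exp 1 ^ (d + 1) = Real.exp ((d + 2 : ℕ) * Real.log (mRp d) + (d + 1 : ℕ)) := by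
      rw [Real.exp_add, Real.exp_nat_mul, Real.exp_log hm0, ← Real.exp_nat_mul, mul_one]
    rw [e1]
    apply Real.exp_le_exp.mpr
    have e2 : ((d + 2 : ℕ) : ℝ) = mRp d + 1 := by unfold mRp; push_cast; ring
    have e3 : ((d + 1 : ℕ) : ℝ) = mRp d := em
    rw [e2, e3]
    have hlogm' : Real.log (mRp d) ≤ mRp d := (Real.log_le_sub_one_of_pos hm0).trans (by linarith)
    calc (mRp d + 1) * Real.log (mRp d) + mRp d ≤ mRp d * (9 + Real.log (mRp d)) := by nlinarith
      _ ≤ mRp d * Real.log (2 ^ 13 * mRp d * P.Vmax) := by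
          rw [hlog13]; exact mul_le_mul_of_nonneg_left (by linarith) hm0.le
      _ ≤ P.Wstarp := hml
  have f3 : (∏ j, P.Vs j) * P.Vel ≤ Real.exp P.Wstarp := by
    -- `Vⱼ, V_θ ≤ V_max`, so the product is `≤ Vmax^{d+1} = exp((d+1) log Vmax) ≤ exp(m log(2^13 m Vmax)) ≤ exp W⋆`
    have hVle : ∀ j, P.Vs j ≤ P.Vmax := fun j => P.hVmax j
    have h1 : (∏ j, P.Vs j) ≤ P.Vmax ^ d := by
      calc (∏ j, P.Vs j) ≤ ∏ _j : Fin d, P.Vmax := prod_le_prod (fun j _ => le_trans zero_le_one (P.hV j)) fun j _ => hVle j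
        _ = P.Vmax ^ d := by rw [prod_const, card_univ, Fintype.card_fin]
    have hVm1 := P.hVmax1
    have hVθ0 : 0 < P.Vmax := by linarith
    calc (∏ j, P.Vs j) * P.Vel ≤ P.Vmax ^ d * P.Vmax :=
          mul_le_mul h1 P.hVθmax (by linarith [P.hVθ1]) (by positivity)
      _ = P.Vmax ^ (d + 1) := by rw [pow_succ]
      _ = Real.exp ((d + 1 : ℕ) * Real.log P.Vmax) := by rw [Real.exp_nat_mul, Real.exp_log hVθ0]
      _ ≤ Real.exp P.Wstarp := by
          apply Real.exp_le_exp.mpr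
          have e : ((d + 1 : ℕ) : ℝ) = mRp d := by unfold mRp; push_cast; ring
          rw [e]
          have hlv : Real.log P.Vmax ≤ Real.log (2 ^ 13 * mRp d * P.Vmax) := by
            apply Real.log_le_log hVθ0
            have : (1 : ℝ) ≤ 2 ^ 13 * mRp d := by nlinarith
            nlinarith
          have hlv0 : 0 ≤ Real.log P.Vmax := Real.log_nonneg hVm1
          calc mRp d * Real.log P.Vmax ≤ mRp d * Real.log (2 ^ 13 * mRp d * P.Vmax) := mul_le_mul_of_nonneg_left hlv hm0.le
            _ ≤ P.Wstarp := hml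
  have f4 : P.Wstarp ≤ Real.exp P.Wstarp := by linarith [Real.add_one_le_exp P.Wstarp]
  have f5 : P.Gp ≤ Real.exp (2 * P.Wstarp) := by linarith [Real.add_one_le_exp (2 * P.Wstarp)]
  unfold Up
  calc Ap ^ (d + 1) * (mRp d ^ (2 * d + 3) / (d + 1).factorial) * ((∏ j, P.Vs j) * P.Vel) * P.Wstarp * P.Gp
      ≤ Real.exp (4 * P.Wstarp) * Real.exp P.Wstarp * Real.exp P.Wstarp * Real.exp P.Wstarp * Real.exp (2 * P.Wstarp) := by
        have := P.U_pos
        have h0 : 0 ≤ mRp d ^ (2 * d + 3) / (d + 1).factorial := by positivity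
        have h00 : 0 ≤ (∏ j, P.Vs j) * P.Vel := by positivity
        gcongr
    _ = Real.exp (9 * P.Wstarp) := by simp only [← Real.exp_add]; ring_nf
    _ ≤ Real.exp (10 * P.Wstarp) := Real.exp_le_exp.mpr (by linarith)

/-- `log T ≤ 10 W⋆` (`T ≤ U`). [folklore]
[cite: Waldschmidt1980, §3.2–§3.3 (pp. 264–266) (source FOLLOWED; the cell’s p-adic adaptation, NOT a printed statement)] -/
theorem log_T_le : Real.log P.Tp ≤ 10 * P.Wstarp := by
  have hT : (P.Tp : ℝ) ≤ P.Up := by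
    have h := P.T_le; have hW := P.one_le_Wstar; have hU := P.U_pos
    refine h.trans (div_le_self hU.le ?_)
    unfold cTp
    have : (1 : ℝ) ≤ 2 ^ (d + 1) := one_le_pow₀ (by norm_num)
    nlinarith
  exact (Real.log_le_log P.T_pos hT).trans P.log_U_le

/-! ### The height exponents: `S₀ (∑ LⱼVⱼ + L_θ V_θ) ≤ 𝔘/(2 c_L')` -/

/-- `S₀ Lⱼ Vⱼ ≤ 𝔘/(2 c_L' m)`. [folklore]
[cite: Waldschmidt1980, §3.2–§3.3 (pp. 264–266) (source FOLLOWED; the cell’s p-adic adaptation, NOT a printed statement)] -/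
theorem S₀LV_le_one (j : Fin d) : (P.S₀p : ℝ) * (P.Lp j * P.Vs j) ≤ P.𝔘p / (2 * cLp' * mRp d) := by
  have hL : (P.Lp j : ℝ) ≤ P.Up / (cLp' * mRp d * 2 ^ (d + 2) * P.S₀p * P.Vs j) := by
    unfold Lp
    exact Nat.floor_le (div_nonneg P.U_pos.le (by unfold cLp'; have := mR_pos P; have := P.S₀_pos; have := P.hV j; positivity))
  have hS := P.S₀_pos; have hV := P.hV j; have hm := mR_pos P
  unfold cLp' at *
  rw [le_div_iff₀ (by positivity)] at hL
  rw [le_div_iff₀ (by positivity)]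
  rw [P.U_eq] at hL
  have key : ((P.S₀p : ℝ) * (P.Lp j * P.Vs j) * (2 * 2 ^ 12 * mRp d)) * 2 ^ (d + 1) ≤ P.𝔘p * 2 ^ (d + 1) := by
    calc ((P.S₀p : ℝ) * (P.Lp j * P.Vs j) * (2 * 2 ^ 12 * mRp d)) * 2 ^ (d + 1)
        = P.Lp j * (2 ^ 12 * mRp d * 2 ^ (d + 2) * P.S₀p * P.Vs j) := by rw [pow_succ]; ring
      _ ≤ 2 ^ (d + 1) * P.𝔘p := hL
      _ = P.𝔘p * 2 ^ (d + 1) := by ring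
  exact le_of_mul_le_mul_right key (by positivity)

/-- `S₀ L_θ V_θ ≤ 𝔘/(2 c_L' m)`. [folklore]
[cite: Waldschmidt1980, §3.2–§3.3 (pp. 264–266) (source FOLLOWED; the cell’s p-adic adaptation, NOT a printed statement)] -/
theorem S₀LθVθ_le : (P.S₀p : ℝ) * (P.Lθp * P.Vel) ≤ P.𝔘p / (2 * cLp' * mRp d) := by
  have hL := P.Lθ_le
  have hS := P.S₀_pos; have hV := P.one_le_Vθ; have hm := mR_pos P
  unfold cLp' at *
  rw [le_div_iff₀ (by positivity)] at hL
  rw [le_div_iff₀ (by positivity)]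
  rw [P.U_eq] at hL
  have key : ((P.S₀p : ℝ) * (P.Lθp * P.Vel) * (2 * 2 ^ 12 * mRp d)) * 2 ^ (d + 1) ≤ P.𝔘p * 2 ^ (d + 1) := by
    calc ((P.S₀p : ℝ) * (P.Lθp * P.Vel) * (2 * 2 ^ 12 * mRp d)) * 2 ^ (d + 1)
        = P.Lθp * (2 ^ 12 * mRp d * 2 ^ (d + 2) * P.S₀p * P.Vel) := by rw [pow_succ]; ring
      _ ≤ 2 ^ (d + 1) * P.𝔘p := hL
      _ = P.𝔘p * 2 ^ (d + 1) := by ring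
  exact le_of_mul_le_mul_right key (by positivity)

/-- **`S₀ (∑ⱼ LⱼVⱼ + L_θ V_θ) ≤ 𝔘/(2 c_L')`** (`d + 1 = m` terms of size `𝔘/(2c_L' m)`).
[cite: Waldschmidt1980, (3.11) (p. 265)] -/
theorem S₀LV_le : (P.S₀p : ℝ) * ((∑ j, P.Lp j * P.Vs j) + P.Lθp * P.Vel) ≤ P.𝔘p / (2 * cLp') := by
  have h1 : ∀ j, (P.S₀p : ℝ) * (P.Lp j * P.Vs j) ≤ P.𝔘p / (2 * cLp' * mRp d) := P.S₀LV_le_one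
  have h2 := P.S₀LθVθ_le
  have hm := mR_pos P
  calc (P.S₀p : ℝ) * ((∑ j, P.Lp j * P.Vs j) + P.Lθp * P.Vel)
      = (∑ j, (P.S₀p : ℝ) * (P.Lp j * P.Vs j)) + P.S₀p * (P.Lθp * P.Vel) := by rw [mul_add, mul_sum]
    _ ≤ (∑ _j : Fin d, P.𝔘p / (2 * cLp' * mRp d)) + P.𝔘p / (2 * cLp' * mRp d) := add_le_add (sum_le_sum fun j _ => h1 j) h2
    _ = (d + 1) * (P.𝔘p / (2 * cLp' * mRp d)) := by rw [sum_const, card_univ, Fintype.card_fin]; simp; ring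
    _ = P.𝔘p / (2 * cLp') := by unfold mRp cLp'; field_simp

/-- `L_θ S₀ ≤ 𝔘/2¹⁴` (`V_θ ≥ 1`, `m ≥ 2`, `c_L' = 2¹²`). [folklore]
[cite: Waldschmidt1980, §3.2–§3.3 (pp. 264–266) (source FOLLOWED; the cell’s p-adic adaptation, NOT a printed statement)] -/
theorem LθS₀_le : (P.Lθp : ℝ) * P.S₀p ≤ P.𝔘p / 2 ^ 14 := by
  have h := P.S₀LθVθ_le
  have hV := P.one_le_Vθ; have hm := two_le_mR P; have hS := P.S₀_pos; have hU := P.𝔘_pos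
  have hL : (0 : ℝ) ≤ P.Lθp := Nat.cast_nonneg _
  unfold cLp' at h
  rw [le_div_iff₀ (by positivity)] at h
  rw [le_div_iff₀ (by positivity)]
  have h1 : (P.Lθp : ℝ) * P.S₀p * 1 ≤ P.Lθp * P.S₀p * P.Vel := mul_le_mul_of_nonneg_left hV (by positivity)
  have h2 : (P.Lθp : ℝ) * P.S₀p * (2 ^ 14) ≤ P.S₀p * (P.Lθp * P.Vel) * (2 * 2 ^ 12 * mRp d) := by
    calc (P.Lθp : ℝ) * P.S₀p * 2 ^ 14 = (P.Lθp * P.S₀p * 1) * (2 * 2 ^ 12 * 2) := by ring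
      _ ≤ (P.Lθp * P.S₀p * P.Vel) * (2 * 2 ^ 12 * mRp d) := by gcongr
      _ = P.S₀p * (P.Lθp * P.Vel) * (2 * 2 ^ 12 * mRp d) := by ring
  linarith

/-! ### The `Δ`-polynomials: `h`, `L_b` -/

/-- `W⋆/G < h` (as reals). [folklore]
[cite: Waldschmidt1980, §3.2–§3.3 (pp. 264–266) (source FOLLOWED; the cell’s p-adic adaptation, NOT a printed statement)] -/
theorem Wstar_div_G_lt_hpar : P.Wstarp / P.Gp < P.hparp := by
  unfold hparp; push_cast; exact Nat.lt_floor_add_one _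

/-- `1 ≤ h`. [folklore]
[cite: Waldschmidt1980, §3.2–§3.3 (pp. 264–266) (source FOLLOWED; the cell’s p-adic adaptation, NOT a printed statement)] -/
theorem one_le_hpar : 1 ≤ P.hparp := Nat.le_add_left 1 _

/-- `0 < h` (real). [folklore]
[cite: Waldschmidt1980, §3.2–§3.3 (pp. 264–266) (source FOLLOWED; the cell’s p-adic adaptation, NOT a printed statement)] -/
theorem hpar_pos : (0 : ℝ) < P.hparp := by have := P.one_le_hpar; exact_mod_cast this

/-- `h G ≤ W⋆ + G`. [folklore]
[cite: Waldschmidt1980, §3.2–§3.3 (pp. 264–266) (source FOLLOWED; the cell’s p-adic adaptation, NOT a printed statement)] -/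
theorem hparG_le : (P.hparp : ℝ) * P.Gp ≤ P.Wstarp + P.Gp := by
  unfold hparp; push_cast
  have hG := P.G_pos
  have h1 : (⌊P.Wstarp / P.Gp⌋₊ : ℝ) ≤ P.Wstarp / P.Gp := Nat.floor_le (div_nonneg (by linarith [P.one_le_Wstar]) hG.le)
  have : (⌊P.Wstarp / P.Gp⌋₊ : ℝ) * P.Gp ≤ P.Wstarp := by rwa [le_div_iff₀ hG] at h1
  nlinarith

/-- `h ≤ 3 W⋆` (and so `h` is lower-order). [folklore]
[cite: Waldschmidt1980, §3.2–§3.3 (pp. 264–266) (source FOLLOWED; the cell’s p-adic adaptation, NOT a printed statement)] -/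
theorem hpar_le : (P.hparp : ℝ) ≤ 3 * P.Wstarp := by
  have h := P.hparG_le; have hG := P.one_le_G; have hGW := P.G_le_two_Wstar; have h0 := P.hpar_pos
  nlinarith

/-- `1 ≤ L_b`. [folklore]
[cite: Waldschmidt1980, §3.2–§3.3 (pp. 264–266) (source FOLLOWED; the cell’s p-adic adaptation, NOT a printed statement)] -/
theorem one_le_Lb : 1 ≤ P.Lbp := Nat.le_add_left 1 _

/-- `h L_b G ≤ 𝔘/c_L + h G`, i.e. **`h L_b G ≤ 𝔘/c_L + W⋆ + G`**. [folklore]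
[cite: Waldschmidt1980, §3.2–§3.3 (pp. 264–266) (source FOLLOWED; the cell’s p-adic adaptation, NOT a printed statement)] -/
theorem hparLbG_le : (P.hparp : ℝ) * P.Lbp * P.Gp ≤ P.𝔘p / cLp + (P.Wstarp + P.Gp) := by
  have hh := P.hpar_pos; have hG := P.G_pos; have hU := P.U_pos
  have hLb : (P.Lbp : ℝ) ≤ P.Up / (cLp * 2 ^ (d + 1) * P.Gp * P.hparp) + 1 := by
    unfold Lbp; push_cast
    have := Nat.floor_le (show 0 ≤ P.Up / (cLp * 2 ^ (d + 1) * P.Gp * P.hparp) by unfold cLp; positivity)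
    linarith
  have e : P.Up / (cLp * 2 ^ (d + 1) * P.Gp * P.hparp) = P.𝔘p / cLp / (P.Gp * P.hparp) := by
    rw [P.U_eq]; unfold cLp; field_simp
  rw [e] at hLb
  have h2 := P.hparG_le
  calc (P.hparp : ℝ) * P.Lbp * P.Gp ≤ P.hparp * (P.𝔘p / cLp / (P.Gp * P.hparp) + 1) * P.Gp := by gcongr
    _ = P.𝔘p / cLp + P.hparp * P.Gp := by field_simp
    _ ≤ P.𝔘p / cLp + (P.Wstarp + P.Gp) := by linarith

/-- `h L_b ≤ 𝔘/c_L + 3W⋆` (`G ≥ 1`). [folklore]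
[cite: Waldschmidt1980, §3.2–§3.3 (pp. 264–266) (source FOLLOWED; the cell’s p-adic adaptation, NOT a printed statement)] -/
theorem hparLb_le : (P.hparp : ℝ) * P.Lbp ≤ P.𝔘p / cLp + 3 * P.Wstarp := by
  have h := P.hparLbG_le; have hG := P.one_le_G; have hGW := P.G_le_two_Wstar
  have h0 : 0 ≤ (P.hparp : ℝ) * P.Lbp := by positivity
  have hU : 0 ≤ P.𝔘p / cLp := by unfold cLp; have := P.𝔘_pos; positivity
  nlinarith

/-! ### The largest evaluation point against `h`: `log((X+h)/h) ≤ 6G` -/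

/-- The largest (scaled) evaluation point of the `Δ`-polynomials: `X = 66 · 2^{d+1} L_θ S₀`
(`|z| ≤ 65 · SK ≤ 65 · 2^{d+J} S₀` at scale `2^{J₀−J} ≤ 2^{J₀} ≤ 2L_θ`). [folklore]
[cite: Waldschmidt1980, §3.2–§3.3 (pp. 264–266) (source FOLLOWED; the cell’s p-adic adaptation, NOT a printed statement)] -/
def Xptp : ℝ := 66 * 2 ^ (d + 1) * P.Lθp * P.S₀p

/-- `0 ≤ X`. [folklore]
[cite: Waldschmidt1980, §3.2–§3.3 (pp. 264–266) (source FOLLOWED; the cell’s p-adic adaptation, NOT a printed statement)] -/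
theorem Xpt_nonneg : 0 ≤ P.Xptp := by unfold Xptp; positivity

/-- `X ≤ 33 U/(c_L' m V_θ)`. [folklore]
[cite: Waldschmidt1980, §3.2–§3.3 (pp. 264–266) (source FOLLOWED; the cell’s p-adic adaptation, NOT a printed statement)] -/
theorem Xpt_le : P.Xptp ≤ 33 * P.Up / (cLp' * mRp d * P.Vel) := by
  have hL := P.Lθ_le
  have hS := P.S₀_pos; have hV := P.one_le_Vθ; have hm := mR_pos P; have hU := P.U_pos
  unfold Xptp cLp' at *
  rw [le_div_iff₀ (by positivity)] at hL
  rw [le_div_iff₀ (by positivity)]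
  have e : (2 : ℝ) ^ (d + 2) = 2 * 2 ^ (d + 1) := by rw [pow_succ]; ring
  rw [e] at hL
  have h2 : (0 : ℝ) < 2 ^ (d + 1) := by positivity
  nlinarith [mul_le_mul_of_nonneg_left hL h2.le]

/-- `Aᵐ m^{2m+1} ≤ e^{3G}`: `35m + 3m log m ≤ 3m(17 log 2 + log m) ≤ 3G`. [folklore]
[cite: Waldschmidt1980, §3.2–§3.3 (pp. 264–266) (source FOLLOWED; the cell’s p-adic adaptation, NOT a printed statement)] -/
theorem A_pow_mul_le : Ap ^ (d + 1) * mRp d ^ (2 * d + 3) ≤ Real.exp (3 * P.Gp) := by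
  have hm := two_le_mR P; have hm0 := mR_pos P; have hVf := P.hVmax1
  have hlogm : 0 ≤ Real.log (mRp d) := Real.log_nonneg (by linarith)
  have h2 : (2 : ℝ) ^ 50 ≤ Real.exp 35 := by
    have := Real.exp_one_gt_d9
    have h3 : (2.7182818283 : ℝ) ^ 35 ≤ Real.exp 1 ^ 35 := by gcongr
    rw [← Real.exp_nat_mul] at h3
    norm_num at h3 ⊢
    linarith
  have f1 : Ap ^ (d + 1) ≤ Real.exp (35 * mRp d) := by
    unfold Ap
    calc ((2 : ℝ) ^ 50) ^ (d + 1) ≤ (Real.exp 35) ^ (d + 1) := by gcongr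
      _ = Real.exp (35 * mRp d) := by rw [← Real.exp_nat_mul]; unfold mRp; push_cast; ring_nf
  have f2 : mRp d ^ (2 * d + 3) ≤ Real.exp (3 * mRp d * Real.log (mRp d)) := by
    calc mRp d ^ (2 * d + 3) = Real.exp ((2 * d + 3 : ℕ) * Real.log (mRp d)) := by
          rw [Real.exp_nat_mul, Real.exp_log hm0]
      _ ≤ Real.exp (3 * mRp d * Real.log (mRp d)) := by
          apply Real.exp_le_exp.mpr
          have e : ((2 * d + 3 : ℕ) : ℝ) = 2 * mRp d + 1 := by unfold mRp; push_cast; ring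
          rw [e]; nlinarith
  have hG : 35 * mRp d + 3 * mRp d * Real.log (mRp d) ≤ 3 * P.Gp := by
    unfold Gp
    have hlog : Real.log (2 ^ 17 * mRp d * P.Vmax) = 17 * Real.log 2 + Real.log (mRp d) + Real.log P.Vmax := by
      rw [Real.log_mul (by positivity) (by linarith), Real.log_mul (by positivity) hm0.ne', Real.log_pow]; push_cast; ring
    rw [hlog]
    have hl2 := Real.log_two_gt_d9
    have hlVf : 0 ≤ Real.log P.Vmax := Real.log_nonneg hVf
    nlinarith
  calc Ap ^ (d + 1) * mRp d ^ (2 * d + 3) ≤ Real.exp (35 * mRp d) * Real.exp (3 * mRp d * Real.log (mRp d)) := by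
        have : (0 : ℝ) ≤ Ap ^ (d + 1) := by unfold Ap; positivity
        gcongr
    _ = Real.exp (35 * mRp d + 3 * mRp d * Real.log (mRp d)) := by rw [← Real.exp_add]
    _ ≤ Real.exp (3 * P.Gp) := Real.exp_le_exp.mpr hG

/-- `∏ Vⱼ ≤ e^{G}` (`d log V_f ≤ m log(2¹⁷ m V_f)`). [folklore]
[cite: Waldschmidt1980, §3.2–§3.3 (pp. 264–266) (source FOLLOWED; the cell’s p-adic adaptation, NOT a printed statement)] -/
theorem prodV_le_exp_G : (∏ j, P.Vs j) ≤ Real.exp P.Gp := by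
  have hm := two_le_mR P; have hm0 := mR_pos P; have hVf := P.hVmax1
  have h1 : (∏ j, P.Vs j) ≤ P.Vmax ^ d := by
    calc (∏ j, P.Vs j) ≤ ∏ _j : Fin d, P.Vmax := prod_le_prod (fun j _ => le_trans zero_le_one (P.hV j)) fun j _ => P.hVmax j
      _ = P.Vmax ^ d := by rw [prod_const, card_univ, Fintype.card_fin]
  refine h1.trans ?_
  have hVf0 : 0 < P.Vmax := by linarith
  rw [← Real.exp_log hVf0, ← Real.exp_nat_mul, Real.exp_le_exp]
  unfold Gp
  have hlv : Real.log P.Vmax ≤ Real.log (2 ^ 17 * mRp d * P.Vmax) := by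
    apply Real.log_le_log hVf0
    have : (1 : ℝ) ≤ 2 ^ 17 * mRp d := by nlinarith
    nlinarith
  have hlv0 : 0 ≤ Real.log P.Vmax := Real.log_nonneg hVf
  have hd : (d : ℝ) ≤ mRp d := by unfold mRp; linarith
  calc (d : ℝ) * Real.log P.Vmax ≤ mRp d * Real.log P.Vmax := mul_le_mul_of_nonneg_right hd hlv0
    _ ≤ mRp d * Real.log (2 ^ 17 * mRp d * P.Vmax) := mul_le_mul_of_nonneg_left hlv hm0.le

/-- `G² ≤ e^{G}` (`e^{G/2} ≥ 1 + G/2 + G²/8 ≥ G`). [folklore]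
[cite: Waldschmidt1980, §3.2–§3.3 (pp. 264–266) (source FOLLOWED; the cell’s p-adic adaptation, NOT a printed statement)] -/
theorem G_sq_le_exp_G : P.Gp ^ 2 ≤ Real.exp P.Gp := by
  have hG := P.G_pos
  have h := Real.quadratic_le_exp_of_nonneg (show 0 ≤ P.Gp / 2 by positivity)
  have h1 : P.Gp ≤ Real.exp (P.Gp / 2) := by nlinarith
  calc P.Gp ^ 2 ≤ Real.exp (P.Gp / 2) ^ 2 := pow_le_pow_left₀ hG.le h1 2
    _ = Real.exp P.Gp := by rw [← Real.exp_nat_mul]; ring_nf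

end PadicW80Par

end Literature.NumberTheory.Transcendental.StewartYu

end Part3

/-!
## Part 4 — port of `Summits/ABC/StewartYu/PadicW80ParD.lean`

# The `p`-adic Waldschmidt parameter record — part D (sequel of `PadicW80ParC`)

Support file (plain definitions and theorems; no named facts): continuation of the twin of
`Waldschmidt1980Params/ParamsB/Sizes/Numeric/Main` on the record `PadicW80Par`
(design, HOME/p1/WP-A4-table.md: `V_max` inside the logarithms `W⋆, G` and an ARBITRARY eliminated size
`1 ≤ V_el ≤ V_max` in `U` — p2's FLAG F-p2-3; `c_S = 2¹⁵` — the `p`-adic zeros-per-`𝔘` ratio; all names carry a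
suffix `p` to keep them apart from the archimedean record `W80Par`). [cite: Waldschmidt1980, §3.2–3.5 (pp. 264–274)]
-/

section Part4

open _root_.Finset _root_.Real
open Literature.NumberTheory.Transcendental Literature.NumberTheory.Transcendental.Waldschmidt1980

namespace Literature.NumberTheory.Transcendental.StewartYu

namespace PadicW80Par

variable {d : ℕ} (P : PadicW80Par d)

/-- **`X/h + 1 ≤ e^{6G}`**: with `h > W⋆/G`,
`X/h ≤ 33 U G/(c_L' m V_θ W⋆) = 33 Aᵐ (m^{2m+1}/m!) (∏Vⱼ) G²/(c_L' m) ≤ e^{3G} e^{G} e^{G}`.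
[folklore]
[cite: Waldschmidt1980, §3.2, §3.5 (pp. 264–265, 274) (source FOLLOWED; the cell’s p-adic adaptation, NOT a printed statement)] -/
theorem Xpt_div_hpar_le : P.Xptp / P.hparp + 1 ≤ Real.exp (6 * P.Gp) := by
  have hh := P.hpar_pos; have hG := P.G_pos; have hW := P.one_le_Wstar; have hm := two_le_mR P
  have hm0 := mR_pos P; have hVf := P.hVmax1; have hVθ := P.one_le_Vθ; have hV1 := P.one_le_prodV
  -- Step 1: `X/h ≤ X G / W⋆`
  have h1 : P.Xptp / P.hparp ≤ P.Xptp * P.Gp / P.Wstarp := by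
    rw [div_le_div_iff₀ hh (by linarith)]
    have := P.Wstar_div_G_lt_hpar
    rw [div_lt_iff₀ hG] at this
    have hX := P.Xpt_nonneg
    nlinarith
  -- Step 2: `X G/W⋆ ≤ Ap^m m^{2m+1} (∏V) G²`
  have h2 : P.Xptp * P.Gp / P.Wstarp ≤ Ap ^ (d + 1) * mRp d ^ (2 * d + 3) * (∏ j, P.Vs j) * P.Gp ^ 2 := by
    have hX := P.Xpt_le
    rw [div_le_iff₀ (by linarith)]
    have hfac : (1 : ℝ) ≤ (d + 1).factorial := by exact_mod_cast Nat.one_le_iff_ne_zero.mpr (Nat.factorial_ne_zero _)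
    have hUeq : P.Up = Ap ^ (d + 1) * (mRp d ^ (2 * d + 3) / (d + 1).factorial) * ((∏ j, P.Vs j) * P.Vel) * P.Wstarp * P.Gp := rfl
    unfold cLp' at hX
    rw [le_div_iff₀ (by positivity)] at hX
    have hA : (0 : ℝ) ≤ Ap ^ (d + 1) := by unfold Ap; positivity
    have key : P.Xptp * (2 ^ 12 * mRp d * P.Vel) * P.Gp ≤ 33 * (Ap ^ (d + 1) * mRp d ^ (2 * d + 3) * (∏ j, P.Vs j) * P.Gp ^ 2 * P.Wstarp * P.Vel) := by
      have hdiv : mRp d ^ (2 * d + 3) / (d + 1).factorial ≤ mRp d ^ (2 * d + 3) := div_le_self (by positivity) hfac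
      calc P.Xptp * (2 ^ 12 * mRp d * P.Vel) * P.Gp ≤ 33 * P.Up * P.Gp := by nlinarith
        _ = 33 * (Ap ^ (d + 1) * (mRp d ^ (2 * d + 3) / (d + 1).factorial) * (∏ j, P.Vs j) * P.Gp ^ 2 * P.Wstarp * P.Vel) := by
            rw [hUeq]; ring
        _ ≤ 33 * (Ap ^ (d + 1) * mRp d ^ (2 * d + 3) * (∏ j, P.Vs j) * P.Gp ^ 2 * P.Wstarp * P.Vel) := by gcongr
    have h33 : 33 * P.Vel ≤ 2 ^ 12 * mRp d * P.Vel := by nlinarith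
    have hZ : 0 ≤ Ap ^ (d + 1) * mRp d ^ (2 * d + 3) * (∏ j, P.Vs j) * P.Gp ^ 2 * P.Wstarp := by positivity
    nlinarith [mul_le_mul_of_nonneg_left h33 (mul_nonneg hZ P.G_pos.le), P.Xpt_nonneg]
  -- Step 3: the exponential bounds
  have f1 := P.A_pow_mul_le
  have f3 := P.prodV_le_exp_G
  have f4 := P.G_sq_le_exp_G
  have h3 : Ap ^ (d + 1) * mRp d ^ (2 * d + 3) * (∏ j, P.Vs j) * P.Gp ^ 2 ≤ Real.exp (5 * P.Gp) := by
    calc Ap ^ (d + 1) * mRp d ^ (2 * d + 3) * (∏ j, P.Vs j) * P.Gp ^ 2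
        = (Ap ^ (d + 1) * mRp d ^ (2 * d + 3)) * (∏ j, P.Vs j) * P.Gp ^ 2 := by ring
      _ ≤ Real.exp (3 * P.Gp) * Real.exp P.Gp * Real.exp P.Gp := by
          have : (0 : ℝ) ≤ Ap ^ (d + 1) * mRp d ^ (2 * d + 3) := by unfold Ap; positivity
          gcongr
      _ = Real.exp (5 * P.Gp) := by simp only [← Real.exp_add]; ring_nf
  have h4 : Real.exp (5 * P.Gp) + 1 ≤ Real.exp (6 * P.Gp) := by
    have hG1 := P.one_le_G
    have e : Real.exp (6 * P.Gp) = Real.exp (5 * P.Gp) * Real.exp P.Gp := by rw [← Real.exp_add]; ring_nf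
    rw [e]
    have h2e : 2 ≤ Real.exp P.Gp := by
      have := Real.add_one_le_exp P.Gp; linarith
    have h5 : 1 ≤ Real.exp (5 * P.Gp) := Real.one_le_exp (by positivity)
    nlinarith
  linarith [h1, h2, h3, h4]

/-- **`log((X + h)/h) ≤ 6 G`.** [cite: Waldschmidt1980, (3.13)–(3.14) (p. 265)] -/
theorem log_Xpt_div_le : Real.log ((P.Xptp + P.hparp) / P.hparp) ≤ 6 * P.Gp := by
  have hh := P.hpar_pos
  have e : (P.Xptp + P.hparp) / P.hparp = P.Xptp / P.hparp + 1 := by field_simp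
  rw [e]
  have h := P.Xpt_div_hpar_le
  have hpos : 0 < P.Xptp / P.hparp + 1 := by have := P.Xpt_nonneg; positivity
  calc Real.log (P.Xptp / P.hparp + 1) ≤ Real.log (Real.exp (6 * P.Gp)) := Real.log_le_log hpos h
    _ = 6 * P.Gp := Real.log_exp _

/-! ## Part C: sizes vector, inner step, nodes (twins of `Waldschmidt1980Sizes/Numeric`) -/

/-- All the sizes: `V` extended by `V_θ` at the last place. [folklore]
[cite: Waldschmidt1980, §3.2, §3.5 (pp. 264–265, 274) (source FOLLOWED; the cell’s p-adic adaptation, NOT a printed statement)] -/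
def Vallp : Fin (d + 1) → ℝ := Fin.snoc P.Vs P.Vel

/-- All the ranges: `L` extended by `L_θ`. [folklore]
[cite: Waldschmidt1980, §3.2, §3.5 (pp. 264–265, 274) (source FOLLOWED; the cell’s p-adic adaptation, NOT a printed statement)] -/
def Lallp : Fin (d + 1) → ℕ := Fin.snoc P.Lp P.Lθp

/-- `Vall (castSucc j) = V j`. [folklore]
[cite: Waldschmidt1980, §3.2, §3.5 (pp. 264–265, 274) (source FOLLOWED; the cell’s p-adic adaptation, NOT a printed statement)] -/
@[simp] theorem Vall_castSucc (j : Fin d) : P.Vallp (Fin.castSucc j) = P.Vs j := by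
  unfold Vallp; rw [Fin.snoc_castSucc]

/-- `Vall last = V_θ`. [folklore]
[cite: Waldschmidt1980, §3.2, §3.5 (pp. 264–265, 274) (source FOLLOWED; the cell’s p-adic adaptation, NOT a printed statement)] -/
@[simp] theorem Vall_last : P.Vallp (Fin.last d) = P.Vel := by
  unfold Vallp; rw [Fin.snoc_last]

/-- `Lall (castSucc j) = L j`. [folklore]
[cite: Waldschmidt1980, §3.2, §3.5 (pp. 264–265, 274) (source FOLLOWED; the cell’s p-adic adaptation, NOT a printed statement)] -/
@[simp] theorem Lall_castSucc (j : Fin d) : P.Lallp (Fin.castSucc j) = P.Lp j := by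
  unfold Lallp; rw [Fin.snoc_castSucc]

/-- `Lall last = L_θ`. [folklore]
[cite: Waldschmidt1980, §3.2, §3.5 (pp. 264–265, 274) (source FOLLOWED; the cell’s p-adic adaptation, NOT a printed statement)] -/
@[simp] theorem Lall_last : P.Lallp (Fin.last d) = P.Lθp := by
  unfold Lallp; rw [Fin.snoc_last]

/-- `1 ≤ Vallᵢ`. [folklore]
[cite: Waldschmidt1980, §3.2, §3.5 (pp. 264–265, 274) (source FOLLOWED; the cell’s p-adic adaptation, NOT a printed statement)] -/
theorem one_le_Vall (i : Fin (d + 1)) : 1 ≤ P.Vallp i := by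
  refine Fin.lastCases ?_ (fun j => ?_) i
  · rw [P.Vall_last]; exact P.one_le_Vθ
  · rw [P.Vall_castSucc]; exact P.hV j

/-- `0 < Vallᵢ`. [folklore]
[cite: Waldschmidt1980, §3.2, §3.5 (pp. 264–265, 274) (source FOLLOWED; the cell’s p-adic adaptation, NOT a printed statement)] -/
theorem Vall_pos (i : Fin (d + 1)) : 0 < P.Vallp i := lt_of_lt_of_le one_pos (P.one_le_Vall i)

/-! ### The inner step size `t_J = ⌊(T/2ᴶ)/(2m)⌋` -/

/-- `t_J = ⌊(T/2ᴶ)/(2m)⌋`: the number of derivatives given up at each of the `m` inner steps of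
level `J` (Waldschmidt's `(1 − k/2n) q^{−J} T`, Lemma 3.6). [cite: Waldschmidt1980, Lemma 3.6 (p. 272)] -/
def tJp (J : ℕ) : ℕ := P.Tp / 2 ^ J / (2 * (d + 1))

/-- `2^J ≤ L_θ` for `J < J₀` (`2^{J₀} ≤ 2 L_θ`). [folklore]
[cite: Waldschmidt1980, §3.2, §3.5 (pp. 264–265, 274) (source FOLLOWED; the cell’s p-adic adaptation, NOT a printed statement)] -/
theorem two_pow_le_Lθ {J : ℕ} (hJ : J < P.J₀p) : 2 ^ J ≤ P.Lθp := by
  have h := P.two_pow_le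
  have : 2 ^ (J + 1) ≤ 2 ^ P.J₀p := Nat.pow_le_pow_right two_pos hJ
  rw [pow_succ] at this
  omega

/-- **`T/2ᴶ ≥ 2¹¹ m²`** for `J < J₀` (`T ≥ 2¹¹ m² V_θ L_θ ≥ 2¹¹ m² 2ᴶ`). [folklore]
[cite: Waldschmidt1980, §3.2, §3.5 (pp. 264–265, 274) (source FOLLOWED; the cell’s p-adic adaptation, NOT a printed statement)] -/
theorem TJ_ge {J : ℕ} (hJ : J < P.J₀p) : 2 ^ 11 * (d + 1) ^ 2 ≤ P.Tp / 2 ^ J := by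
  rw [Nat.le_div_iff_mul_le (Nat.pow_pos two_pos)]
  have h := P.T_ge_Lθ
  have hL := P.two_pow_le_Lθ hJ
  have hV := P.one_le_Vθ
  have : ((2 ^ 11 * (d + 1) ^ 2 * 2 ^ J : ℕ) : ℝ) ≤ P.Tp := by
    refine le_trans ?_ h
    have hL' : ((2 : ℝ) ^ J) ≤ P.Lθp := by exact_mod_cast hL
    have e : ((2 ^ 11 * (d + 1) ^ 2 * 2 ^ J : ℕ) : ℝ) = 2 ^ 11 * mRp d ^ 2 * 2 ^ J := by
      unfold mRp; push_cast; ring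
    rw [e]
    have h0 : (0 : ℝ) ≤ 2 ^ 11 * mRp d ^ 2 := by positivity
    have hL0 : (0 : ℝ) ≤ P.Lθp := Nat.cast_nonneg _
    calc (2 : ℝ) ^ 11 * mRp d ^ 2 * 2 ^ J = 2 ^ 11 * mRp d ^ 2 * 1 * 2 ^ J := by ring
      _ ≤ 2 ^ 11 * mRp d ^ 2 * P.Vel * P.Lθp :=
          mul_le_mul (mul_le_mul_of_nonneg_left hV h0) hL' (by positivity) (mul_nonneg h0 (by linarith))
  exact_mod_cast this

/-- `1 ≤ t_J` for `J < J₀`. [folklore]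
[cite: Waldschmidt1980, §3.2, §3.5 (pp. 264–265, 274) (source FOLLOWED; the cell’s p-adic adaptation, NOT a printed statement)] -/
theorem one_le_tJ {J : ℕ} (hJ : J < P.J₀p) : 1 ≤ P.tJp J := by
  unfold tJp
  rw [Nat.le_div_iff_mul_le (by omega)]
  have := P.TJ_ge hJ
  nlinarith

/-- `2m · t_J ≤ T/2ᴶ`. [folklore]
[cite: Waldschmidt1980, §3.2, §3.5 (pp. 264–265, 274) (source FOLLOWED; the cell’s p-adic adaptation, NOT a printed statement)] -/
theorem tJ_mul_le (J : ℕ) : 2 * (d + 1) * P.tJp J ≤ P.Tp / 2 ^ J := by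
  unfold tJp; rw [Nat.mul_comm]; exact Nat.div_mul_le_self _ _

/-- `t_J ≤ T`. [folklore]
[cite: Waldschmidt1980, §3.2, §3.5 (pp. 264–265, 274) (source FOLLOWED; the cell’s p-adic adaptation, NOT a printed statement)] -/
theorem tJ_le_T (J : ℕ) : P.tJp J ≤ P.Tp :=
  ((Nat.div_le_self _ _).trans (Nat.div_le_self _ _))

/-- `t_J ≤ T/(2ᴶ · 2m)` (real). [folklore]
[cite: Waldschmidt1980, §3.2, §3.5 (pp. 264–265, 274) (source FOLLOWED; the cell’s p-adic adaptation, NOT a printed statement)] -/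
theorem tJ_le_real (J : ℕ) : (P.tJp J : ℝ) ≤ P.Tp / (2 ^ J * (2 * mRp d)) := by
  have h1 : ((P.tJp J : ℕ) : ℝ) ≤ ((P.Tp / 2 ^ J : ℕ) : ℝ) / (2 * mRp d) := by
    unfold tJp
    have := Nat.cast_div_le (α := ℝ) (m := P.Tp / 2 ^ J) (n := 2 * (d + 1))
    have em : ((2 * (d + 1) : ℕ) : ℝ) = 2 * mRp d := by unfold mRp; push_cast; ring
    rwa [em] at this
  have h2 : ((P.Tp / 2 ^ J : ℕ) : ℝ) ≤ (P.Tp : ℝ) / 2 ^ J := by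
    have := Nat.cast_div_le (α := ℝ) (m := P.Tp) (n := 2 ^ J)
    push_cast at this; exact this
  have hm := mR_pos P
  calc (P.tJp J : ℝ) ≤ ((P.Tp / 2 ^ J : ℕ) : ℝ) / (2 * mRp d) := h1
    _ ≤ ((P.Tp : ℝ) / 2 ^ J) / (2 * mRp d) := div_le_div_of_nonneg_right h2 (by positivity)
    _ = P.Tp / (2 ^ J * (2 * mRp d)) := by rw [div_div]

omit P in
/-- `⌊a/b⌋ ≥ a/b − 1` for naturals, as reals. [folklore] -/
private theorem natDiv_ge_real (a b : ℕ) (hb : 0 < b) : (a : ℝ) / b - 1 ≤ ((a / b : ℕ) : ℝ) := by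
  have h := Nat.lt_div_mul_add hb (a := a)
  have hb' : (0 : ℝ) < b := by exact_mod_cast hb
  rw [div_sub_one hb'.ne', div_le_iff₀ hb']
  have : (a : ℝ) < (a / b : ℕ) * b + b := by exact_mod_cast h
  linarith

/-- `t_J ≥ T/(2ᴶ · 2m) − 2` (real). [folklore]
[cite: Waldschmidt1980, §3.2, §3.5 (pp. 264–265, 274) (source FOLLOWED; the cell’s p-adic adaptation, NOT a printed statement)] -/
theorem tJ_ge_real (J : ℕ) : (P.Tp : ℝ) / (2 ^ J * (2 * mRp d)) - 2 ≤ P.tJp J := by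
  have hm := mR_pos P
  have h1 := natDiv_ge_real (P.Tp / 2 ^ J) (2 * (d + 1)) (by omega)
  have h2 := natDiv_ge_real P.Tp (2 ^ J) (Nat.pow_pos two_pos)
  have em : ((2 * (d + 1) : ℕ) : ℝ) = 2 * mRp d := by unfold mRp; push_cast; ring
  rw [em] at h1
  push_cast at h2
  unfold tJp
  have h3 : ((P.Tp : ℝ) / 2 ^ J - 1) / (2 * mRp d) ≤ ((P.Tp / 2 ^ J : ℕ) : ℝ) / (2 * mRp d) :=
    div_le_div_of_nonneg_right h2 (by positivity)
  have h4 : (P.Tp : ℝ) / (2 ^ J * (2 * mRp d)) - 2 ≤ ((P.Tp : ℝ) / 2 ^ J - 1) / (2 * mRp d) - 1 := by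
    rw [← div_div, sub_div]
    have : 1 / (2 * mRp d) ≤ 1 := by
      rw [div_le_one (by positivity)]; linarith [two_le_mR P]
    linarith
  linarith

/-- `T ≥ 𝔘/(c_T W⋆) − 1` (real). [folklore]
[cite: Waldschmidt1980, §3.2, §3.5 (pp. 264–265, 274) (source FOLLOWED; the cell’s p-adic adaptation, NOT a printed statement)] -/
theorem T_ge_real : P.𝔘p / (cTp * P.Wstarp) - 1 ≤ P.Tp := by
  unfold Tp
  have e : P.Up / (cTp * 2 ^ (d + 1) * P.Wstarp) = P.𝔘p / (cTp * P.Wstarp) := by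
    rw [P.U_eq]; unfold cTp; field_simp
  rw [e]
  have h1 := Nat.lt_floor_add_one (P.𝔘p / (cTp * P.Wstarp))
  linarith

/-! ### The interpolation nodes `kpts = 2^{k+J} S₀ / 2` -/

/-- `2^{k+J} S₀ / 2 = 2^{k+J} ⌊c_S m W⋆⌋` exactly (`S₀` is even). [folklore]
[cite: Waldschmidt1980, §3.2, §3.5 (pp. 264–265, 274) (source FOLLOWED; the cell’s p-adic adaptation, NOT a printed statement)] -/
theorem kpts_eq (J k : ℕ) : 2 ^ (k + J) * P.S₀p / 2 = 2 ^ (k + J) * ⌊cSp * mRp d * P.Wstarp⌋₊ := by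
  unfold S₀p
  rw [show 2 ^ (k + J) * (2 * ⌊cSp * mRp d * P.Wstarp⌋₊) = 2 ^ (k + J) * ⌊cSp * mRp d * P.Wstarp⌋₊ * 2 by ring,
    Nat.mul_div_cancel _ two_pos]

/-- `kpts ≤ 2^{k+J} c_S m W⋆` (real). [folklore]
[cite: Waldschmidt1980, §3.2, §3.5 (pp. 264–265, 274) (source FOLLOWED; the cell’s p-adic adaptation, NOT a printed statement)] -/
theorem kpts_le_real (J k : ℕ) : ((2 ^ (k + J) * P.S₀p / 2 : ℕ) : ℝ) ≤ 2 ^ (k + J) * (cSp * mRp d * P.Wstarp) := by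
  rw [P.kpts_eq]; push_cast
  have := Nat.floor_le (show 0 ≤ cSp * mRp d * P.Wstarp by have := P.cS_mul_ge; linarith)
  gcongr

/-- `kpts ≥ 2^{k+J} (c_S m W⋆ − 1)` (real). [folklore]
[cite: Waldschmidt1980, §3.2, §3.5 (pp. 264–265, 274) (source FOLLOWED; the cell’s p-adic adaptation, NOT a printed statement)] -/
theorem kpts_ge_real (J k : ℕ) : 2 ^ (k + J) * (cSp * mRp d * P.Wstarp - 1) ≤ ((2 ^ (k + J) * P.S₀p / 2 : ℕ) : ℝ) := by
  rw [P.kpts_eq]; push_cast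
  have := (Nat.lt_floor_add_one (cSp * mRp d * P.Wstarp)).le
  have h0 : (0 : ℝ) ≤ 2 ^ (k + J) := by positivity
  nlinarith

/-- `kpts ≤ 2^{d+J₀} S₀` for `k ≤ d`, `J ≤ J₀`. [folklore]
[cite: Waldschmidt1980, §3.2, §3.5 (pp. 264–265, 274) (source FOLLOWED; the cell’s p-adic adaptation, NOT a printed statement)] -/
theorem kpts_le_nat {J k : ℕ} (hJ : J ≤ P.J₀p) (hk : k ≤ d) : 2 ^ (k + J) * P.S₀p / 2 ≤ 2 ^ (d + P.J₀p) * P.S₀p :=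
  (Nat.div_le_self _ _).trans (Nat.mul_le_mul_right _ (Nat.pow_le_pow_right two_pos (by omega)))

/-- **Upper bound `kpts · t_J ≤ 2ᵏ 𝔘`** (`c_S/c_T = 2`). [cite: Waldschmidt1980, Lemma 3.5 (p. 271)] -/
theorem KT_le (J k : ℕ) : ((2 ^ (k + J) * P.S₀p / 2 : ℕ) : ℝ) * (P.tJp J : ℝ) ≤ 2 ^ k * P.𝔘p := by
  have h1 := P.kpts_le_real J k
  have h2 := P.tJ_le_real J
  have hm := mR_pos P; have hW := P.one_le_Wstar; have hT := P.T_pos; have hTW := P.TWstar_le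
  have h0 : (0 : ℝ) ≤ ((2 ^ (k + J) * P.S₀p / 2 : ℕ) : ℝ) := Nat.cast_nonneg _
  have hW0 : 0 < P.Wstarp := by linarith
  have hcS0 : (0 : ℝ) < cSp := by unfold cSp; norm_num
  calc ((2 ^ (k + J) * P.S₀p / 2 : ℕ) : ℝ) * (P.tJp J : ℝ)
      ≤ (2 ^ (k + J) * (cSp * mRp d * P.Wstarp)) * (P.Tp / (2 ^ J * (2 * mRp d))) :=
        mul_le_mul h1 h2 (Nat.cast_nonneg _) (by positivity)
    _ = 2 ^ k * cSp * (P.Tp * P.Wstarp) / 2 := by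
        rw [pow_add]; field_simp
    _ ≤ 2 ^ k * cSp * (P.𝔘p / cTp) / 2 := by gcongr
    _ = 2 ^ k * P.𝔘p := by unfold cSp cTp; ring

set_option maxHeartbeats 400000 in
/-- **Lower bound `kpts · t_J ≥ (31/32)·2ᵏ 𝔘`** for `J < J₀`. [cite: Waldschmidt1980, Lemma 3.5 (p. 271)] -/
theorem KT_ge {J : ℕ} (hJ : J < P.J₀p) (k : ℕ) :
    31 / 32 * (2 ^ k * P.𝔘p) ≤ ((2 ^ (k + J) * P.S₀p / 2 : ℕ) : ℝ) * (P.tJp J : ℝ) := by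
  have h1 := P.kpts_ge_real J k
  have h2 := P.tJ_ge_real J
  have h3 := P.T_ge_real
  have hm := mR_pos P; have hm2 := two_le_mR P; have hW := P.one_le_Wstar; have hU := P.𝔘_pos
  have hcS := P.cS_mul_ge
  have hWU := P.Wstar_le_𝔘
  -- `2^{J+1} c_S m W⋆ ≤ 𝔘/2^{13}` : `2^{J} ≤ Lθ ≤ 𝔘/(2^14 S₀)` and `S₀ ≥ c_S m W⋆`
  have hJL : (2 : ℝ) ^ J ≤ P.Lθp := by exact_mod_cast P.two_pow_le_Lθ hJ
  have hLS := P.LθS₀_le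
  have hS₀ := P.S₀_ge
  have hsmall : (2 : ℝ) ^ J * (cSp * mRp d * P.Wstarp) ≤ P.𝔘p / 2 ^ 14 := by
    calc (2 : ℝ) ^ J * (cSp * mRp d * P.Wstarp) ≤ P.Lθp * P.S₀p := mul_le_mul hJL hS₀ (by linarith) (Nat.cast_nonneg _)
      _ ≤ P.𝔘p / 2 ^ 14 := hLS
  have ht0 : (0 : ℝ) ≤ P.tJp J := Nat.cast_nonneg _
  -- `2^J t_J ≥ T/(2m) − 2^{J+1}`
  have h2J : (0 : ℝ) < 2 ^ J := by positivity
  have h2' : (P.Tp : ℝ) / (2 * mRp d) - 2 * 2 ^ J ≤ 2 ^ J * (P.tJp J : ℝ) := by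
    have := mul_le_mul_of_nonneg_left h2 h2J.le
    have e : (2 : ℝ) ^ J * (P.Tp / (2 ^ J * (2 * mRp d)) - 2) = P.Tp / (2 * mRp d) - 2 * 2 ^ J := by
      field_simp
    linarith
  -- the main term: `(Ap − 1)(𝔘/(c_T W⋆) − 1)/(2m) ≥ 𝔘/4 − c_S W⋆/2 − 𝔘/(2m c_T W⋆)` with `Ap = c_S m W⋆`
  set Ap : ℝ := cSp * mRp d * P.Wstarp with hA
  have hA1 : 1 ≤ Ap := le_trans (by norm_num) hcS
  have eA : Ap * (P.𝔘p / (cTp * P.Wstarp)) = 2 * mRp d * P.𝔘p := by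
    rw [hA]; unfold cSp cTp; field_simp
  have hmain : 31 / 32 * P.𝔘p ≤ (Ap - 1) * (P.Tp / (2 * mRp d) - 2 * 2 ^ J) := by
    -- (a) `(Ap-1) T/(2m) ≥ (Ap-1)(𝔘/(c_T W⋆) - 1)/(2m)`
    have ha : (Ap - 1) * ((P.𝔘p / (cTp * P.Wstarp) - 1) / (2 * mRp d)) ≤ (Ap - 1) * (P.Tp / (2 * mRp d)) :=
      mul_le_mul_of_nonneg_left (div_le_div_of_nonneg_right h3 (by positivity)) (by linarith)
    -- (b) expand `(Ap-1)(𝔘/(c_T W⋆) - 1) = Ap 𝔘/(c_T W⋆) - Ap - 𝔘/(c_T W⋆) + 1`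
    have hb : (Ap - 1) * ((P.𝔘p / (cTp * P.Wstarp) - 1) / (2 * mRp d)) =
        (2 * mRp d * P.𝔘p - Ap - P.𝔘p / (cTp * P.Wstarp) + 1) / (2 * mRp d) := by
      rw [← eA]; ring
    -- (c) the pieces
    have hc1 : (2 * mRp d * P.𝔘p - Ap - P.𝔘p / (cTp * P.Wstarp) + 1) / (2 * mRp d) =
        P.𝔘p - Ap / (2 * mRp d) - P.𝔘p / (cTp * P.Wstarp) / (2 * mRp d) + 1 / (2 * mRp d) := by
      field_simp
    have hc2 : Ap / (2 * mRp d) = cSp * P.Wstarp / 2 := by rw [hA]; field_simp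
    have hc3 : P.𝔘p / (cTp * P.Wstarp) / (2 * mRp d) ≤ P.𝔘p / 2 ^ 16 := by
      rw [div_div, div_le_div_iff₀ (by unfold cTp; positivity) (by norm_num)]
      unfold cTp
      have : (2 : ℝ) ^ 16 ≤ 2 ^ 14 * P.Wstarp * (2 * mRp d) := by nlinarith
      nlinarith
    have hc4 : 0 ≤ 1 / (2 * mRp d) := by positivity
    have hWs : cSp * P.Wstarp / 2 ≤ P.𝔘p / 2 ^ 84 := by
      unfold cSp; rw [div_le_div_iff₀ (by norm_num) (by norm_num)]; nlinarith
    -- (d) `(Ap-1) · 2 · 2^J ≤ 2 · 2^J Ap ≤ 𝔘/2^13`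
    have hd : (Ap - 1) * (2 * 2 ^ J) ≤ P.𝔘p / 2 ^ 13 := by
      have : (Ap - 1) * (2 * 2 ^ J) ≤ 2 * (2 ^ J * Ap) := by nlinarith
      have h14 : 2 * (P.𝔘p / 2 ^ 14) = P.𝔘p / 2 ^ 13 := by ring
      rw [hA] at this ⊢; linarith
    have htot : (Ap - 1) * (P.Tp / (2 * mRp d) - 2 * 2 ^ J) = (Ap - 1) * (P.Tp / (2 * mRp d)) - (Ap - 1) * (2 * 2 ^ J) := by ring
    rw [htot]
    have : P.𝔘p - P.𝔘p / 2 ^ 84 - P.𝔘p / 2 ^ 16 - P.𝔘p / 2 ^ 13 ≥ 31 / 32 * P.𝔘p := by nlinarith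
    linarith [ha, hb, hc1, hc2, hc3, hc4, hWs, hd]
  -- positivity of the bracket, then the product bound
  have hX : 0 < P.Tp / (2 * mRp d) - 2 * 2 ^ J := by
    by_contra hneg
    push Not at hneg
    have : (Ap - 1) * (P.Tp / (2 * mRp d) - 2 * 2 ^ J) ≤ 0 := mul_nonpos_of_nonneg_of_nonpos (by linarith) hneg
    linarith [hU]
  have hk1 : 2 ^ k * (Ap - 1) * 2 ^ J ≤ ((2 ^ (k + J) * P.S₀p / 2 : ℕ) : ℝ) := by
    have : (2 : ℝ) ^ k * (Ap - 1) * 2 ^ J = 2 ^ (k + J) * (Ap - 1) := by rw [pow_add]; ring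
    rw [this]; exact h1
  calc (31 : ℝ) / 32 * (2 ^ k * P.𝔘p) = 2 ^ k * (31 / 32 * P.𝔘p) := by ring
    _ ≤ 2 ^ k * ((Ap - 1) * (P.Tp / (2 * mRp d) - 2 * 2 ^ J)) := by gcongr
    _ ≤ 2 ^ k * ((Ap - 1) * (2 ^ J * (P.tJp J : ℝ))) := by
        have hA0 : 0 ≤ Ap - 1 := by linarith
        have h2k : (0 : ℝ) ≤ 2 ^ k := by positivity
        exact mul_le_mul_of_nonneg_left (mul_le_mul_of_nonneg_left h2' hA0) h2k
    _ = (2 ^ k * (Ap - 1) * 2 ^ J) * (P.tJp J : ℝ) := by ring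
    _ ≤ ((2 ^ (k + J) * P.S₀p / 2 : ℕ) : ℝ) * (P.tJp J : ℝ) := mul_le_mul_of_nonneg_right hk1 ht0

/-! ## Part D: the endgame numbers (twin of `PadicW80Par.endgame_numbers`) -/

/-- `#{s < 2n : s odd} = n`. [folklore] -/
private theorem card_odd_range_two_mul (n : ℕ) : ((range (2 * n)).filter Odd).card = n := by
  induction n with
  | zero => simp
  | succ n ih =>
    rw [show 2 * (n + 1) = (2 * n + 1) + 1 by ring, range_add_one, range_add_one, filter_insert, filter_insert]
    have hodd : Odd (2 * n + 1) := ⟨n, rfl⟩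
    have heven : ¬ Odd (2 * n) := by rw [Nat.not_odd_iff_even]; exact ⟨n, by ring⟩
    rw [if_pos hodd, if_neg heven, card_insert_of_notMem, ih]
    simp

/-- `#{s < 2^{J₀} S₀ : s odd} = 2^{J₀} ⌊c_S m W⋆⌋` (`S₀ = 2⌊c_S m W⋆⌋`). [folklore]
[cite: Waldschmidt1980, §3.2, §3.5 (pp. 264–265, 274) (source FOLLOWED; the cell’s p-adic adaptation, NOT a printed statement)] -/
theorem card_odd_eq : ((range (2 ^ P.J₀p * P.S₀p)).filter Odd).card = 2 ^ P.J₀p * ⌊cSp * mRp d * P.Wstarp⌋₊ := by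
  unfold S₀p
  rw [show 2 ^ P.J₀p * (2 * ⌊cSp * mRp d * P.Wstarp⌋₊) = 2 * (2 ^ P.J₀p * ⌊cSp * mRp d * P.Wstarp⌋₊) by ring]
  exact card_odd_range_two_mul _

end PadicW80Par

end Literature.NumberTheory.Transcendental.StewartYu

end Part4

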